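import Literature.ComputerArithmetic.LangloisLouvet2006.CompHorner
import Literature.ComputerArithmetic.GraillatJezequelPicot2018.SumKDotK
import Literature.ComputerArithmetic.GraillatJezequelPicot2018.CompHornerDirected

/-!
# `EFTHornerK` and `CompHornerK`: polynomial evaluation "in `K` times the working precision"
(Graillat–Langlois–Louvet 2009, §§5–6)

HONEST FRAMING (ENGINES group, unit `eng-quad-4`, kernels lane of the `certquad` engine — shared
numerical engines serving client cells; rigour lives in the verifiers; every published number
belongs to a client cell's ledger, not to the engines group): the lane's in-tree anchors already
type the once-compensated Horner scheme (`LangloisLouvet2006/CompHorner.lean`,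
`GraillatJezequelPicot2018/CompHornerDirected.lean`) and the cascaded compensated summation `SumK`
(`GraillatJezequelPicot2018/SumKDotK.lean`). This file types and PROVES, in the same MODEL (it
imports those files and reuses their engine lemmas), the published analysis of the COMBINATION of
the two — `K - 1` levels of the Horner error-free transformation followed by `SumK`, i.e.
evaluation "as accurate as if computed in `K` times the working precision": THEOREM 16,
PROPOSITION 17, LEMMA 21 and THEOREM 20 of the source, with THEOREM 18 (= `SumK`,
Ogita–Rump–Oishi, the source's [18]) taken from `SumKDotK.lean` at `v = u`. No hardware, vendor,
timing or format claims; the format-level facts of the source (the standard model, eq. (4); the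
exactness and error sizes of `TwoSum` / `TwoProd`, THEOREM 4; "even in presence of underflow" in
THEOREM 18) are HYPOTHESES here (trace form), or hold by fiat in the literal `rd`-model of the
last section.

Source read at the page: [GraillatLangloisLouvet2009] (Japan J. Indust. Appl. Math. 26 (2009)
191–214; read in the authors' version, HAL hal-00285603, whose numbering is used below): §2.1
(eq. (4), `γₖ = ku/(1 - ku)`), §2.2 (eq. (6), Algorithms 1–3, THEOREM 4), §3.1 (eq. (7): `p̃`,
`cond(p, x)`; Algorithm 5 `Horner`; eq. (8)), §3.2 (Algorithm 6 `EFTHorner`, THEOREM 7,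
eqs. (9)–(10)), §5.1 (Figure 3; the index sets `N_T`, `N_I`, `N_L`; eqs. (17)–(18); Algorithm 15
`EFTHornerK`), §5.2 (THEOREM 16 eq. (19); PROPOSITION 17 eq. (20)), §6.1 (eqs. (21)–(22);
THEOREM 18 eq. (23)), §6.2 (Algorithm 19 `CompHornerK`; THEOREM 20 eq. (24); LEMMA 21; the
proofs of both).

THE MODEL (ordered field `K`; `u ≥ 0`).
* The binary tree of Figure 3 is indexed by (level, position): node `(ℓ, j)`, `ℓ ≤ L`, `j < 2^ℓ`,
  is the paper's node `i = 2^ℓ + j ∈ N_T`, at the paper's level `ℓ + 1`; its children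
  `(ℓ+1, 2j)`, `(ℓ+1, 2j+1)` are the nodes `2i`, `2i+1`. The paper's `K` (number of levels) is
  our `L + 1`, so `2 ≤ K` reads `1 ≤ L`; the internal nodes `N_I` are the levels `ℓ < L`
  (`2^{K-1} - 1` nodes), the leaves `N_L` the level `L` (`2^{K-1}` nodes), and
  `card N_T = 2^K - 1 = 2^{L+1} - 1`. Degrees are fixed by the leaf degree `d`: node `(ℓ, j)` has
  degree `d + (L - ℓ)`, the root `p₁ = p_{(0,0)}` has degree `n = d + L` (so `d = n - K + 1`, and
  `K ≤ n + 1` is automatic). `nodeVal` / `nodeAbs` are `p_{(ℓ,j)}(x)` and `p̃_{(ℓ,j)}(x)` (eq. (7))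
  read off a coefficient table `A ℓ j i`; the row `(hᵢ)_{i ∈ N_T}` handed to `SumK` is `flat H`
  (`flat H t = H ℓ j` for `t + 1 = 2^ℓ + j`).
* `IsEFTHornerK u x d L A S P H` is Algorithm 15 as a TRACE: at every internal node the
  recurrences of Algorithm 6 hold with EXACT transformations (eq. (6)) whose errors — the
  coefficients of the two children, eq. (17) — are `u`-small relative to the exact operation
  results (THEOREM 4), and `H ℓ j` is the node's computed value `Horner(p_{(ℓ,j)}, x)`.
  `IsLeafHorner u x d L A H E Δ`: the leaves are evaluated by `Horner` in the standard model
  (`Higham2002.hornerFl`, relative errors `E`, `Δ` of size `≤ u`), as Algorithm 19 line 2 does.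
* The final summation (Algorithm 19 line 3: `SumK` with the paper's `K`) enters the abstract
  theorems only through THEOREM 18's bound (23) on that row of `N = 2^K - 1` values, as the
  HYPOTHESIS `hres`: `|res - s| ≤ (u + 3γ²_M)|s| + γ₂ₘ^K s̃` with `M = N - 1 = 2^K - 2`
  (`γ_{N-1} = γ_{2^K-2} = γ_M`, `γ_{2N-2} = γ_{2^{K+1}-4} = γ₂ₘ`), `s = Σ hᵢ`, `s̃ = Σ |hᵢ|`.
  `abs_compHornerK_sub_le_of_sumK` discharges it from a `SumK` trace
  (`GraillatJezequelPicot2018.IsVecSumPass`: `K - 1 = L` exact passes, then a recursive sum; its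
  hypothesis is `4Mu ≤ 1`), and `abs_compHornerK_rd_sub_le` from the literal program.
* Hypotheses on `u`: `2nu < 1` / `4nu < 1` where `γ₂ₙ` / `γ₄ₙ` occur (the paper's standing
  "`ku < 1` whenever `γₖ` is written"), `2Mu < 1` where `γ₂ₘ` occurs, and THEOREM 18's `4Mu ≤ 1`
  for the `γ`-simplified forms of THEOREM 20. The printed hypothesis `(2^K - 2) γ₂ₙ₊₁ ≤ 1` of
  LEMMA 21 / THEOREM 20 is not needed (note (a) below).

Typed and PROVED:

* THEOREM 16 — `nodeVal_root_eq_levels` (the induction on the number of levels of its proof) and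
  eq. (19) `eftHornerK_eq`: `p₁(x) = Σ_{i ∈ N_I} hᵢ + Σ_{i ∈ N_L} pᵢ(x)`; the identity of
  eq. (20), `nodeVal_root_sub_sum_eq`: `p₁(x) - Σ_{i ∈ N_T} hᵢ = Σ_{i ∈ N_L} (pᵢ(x) - hᵢ)`.
* eq. (10) down the tree — `nodeAbs_children_le` (THEOREM 7 at one node, from
  `LangloisLouvet2006.sum_abs_pi_add_abs_sigma_le`), `levelAbs_succ_le`, `levelAbs_le_pow`
  (`Σ_{level ℓ} p̃ᵢ(x) ≤ ((1+u)^{2n} - 1)^ℓ p̃₁(x)` — the quantitative content of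
  "`p̃ᵢ(x) ≤ γ₂ₙ p̃₁(x)`" in the proof of LEMMA 21).
* PROPOSITION 17, eq. (20) — `abs_nodeVal_root_sub_sum_le` (sharp product form
  `((1+u)^{2d} - 1)((1+u)^{2n} - 1)^{K-1} p̃₁(x)`, from eq. (8) at the leaves, `abs_leaf_sub_le`,
  by `Higham2002.abs_hornerFl_sub_sum_le`), `abs_nodeVal_root_sub_sum_le_gamma`
  (`γ_{2(n-K+1)} γ₂ₙ^{K-1} p̃₁(x)`, `2nu < 1`) and, AS PRINTED,
  `abs_nodeVal_root_sub_sum_le_gamma_four` (`γ_{2(n-K+1)} γ₄ₙ^{K-1} p̃₁(x)`, `4nu < 1`).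
* LEMMA 21 — `sum_abs_le`: `Σ_{i ∈ N_T} |hᵢ| ≤ |p₁(x)| + γ₄ₙ p̃₁(x)` under `4nu < 1` ALONE, and
  on the row, `sum_abs_flat_le`; its ingredients `abs_root_le` (`|h₁| ≤ |p₁(x)| + ((1+u)^{2n} - 1)
  p̃₁(x)`, eq. (8)), `abs_nonroot_le`, `root_add_rest_le` (the real-number
  heart: `G T + c R ≤ γ₄ₙ T` for `G = (1+u)^{2n} - 1`, `c = (1+u)^{2n-2}`, `R ≤ G (T + R)`), `rest_le`.
* THEOREM 20 — `abs_compHornerK_sub_le`, SHARP: under `4nu < 1`, `2Mu < 1`,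
  `|res - p₁(x)| ≤ (u + 3γ²_M + γ₂ₘ^K)|p₁(x)| + ((1 + u + 3γ²_M) γ_{2d} γ₂ₙ^{K-1} + γ₄ₙ γ₂ₘ^K) p̃₁(x)`;
  `abs_compHornerK_sub_le_gamma`, the last display of the printed proof — indeed without its
  `γ₄ₙ^{K+1}` term: `… + (γ₂ₙ γ₄ₙ^{K-1} + γ₄ₙ γ₂ₘ^K) p̃₁(x)` (`2 ≤ K`, `4nu < 1`, `4Mu ≤ 1`);
  `abs_compHornerK_sub_le_gamma_four`, the shape of eq. (24):
  `… + (γ₄ₙ^K + γ₄ₙ γ₂ₘ^K + γ₄ₙ^{K+1}) p̃₁(x)` (middle constant `γ₄ₙ`, note (b)); eq. (22), the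
  relative form with `cond(p₁, x) = Higham2002.condPoly`, `abs_compHornerK_sub_div_le`; with
  THEOREM 18 discharged from a `SumK` trace, `abs_compHornerK_sub_le_of_sumK`; the size lemma
  `alpha_le_one` (`4Mu ≤ 1`, `M ≥ 1` ⇒ `u + 3γ²_M ≤ 1`).
* ALGORITHMS 15 AND 19 LITERALLY, for a rounding map `rd : K → K` with `|rd t - t| ≤ u|t|`
  (eq. (4)) and exact transformations (THEOREM 4): `treeCoeff` / `treeS` / `treeP` / `treeH` (the
  `EFTHornerK` tree; children by `childCoeff` = the exact `TwoProd` / `TwoSum` errors, eq. (17)),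
  `treeE` / `treeΔ` (the leaves' relative errors, via `relErr`), `compHornerK rd x a d L`
  (Algorithm 19: `GraillatJezequelPicot2018.sumK` of the row); `isEFTHornerK_tree` and
  `isLeafHorner_tree` (the literal program IS a trace; `hornerRd_eq_hornerFl` identifies `Horner`
  under `rd` with `Higham2002.hornerFl`); and the end-to-end bound `abs_compHornerK_rd_sub_le`
  (THEOREM 20, sharp form, for `compHornerK rd x a d L` against `Σ_{i ≤ n} aᵢ xⁱ`, under `2 ≤ K`,
  `4nu < 1`, `4Mu ≤ 1`).

TWO NOTES ON THE PRINTED PROOFS (every STATEMENT formalised is the printed one or implies it,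
except for the middle constant of (24), note (b)).
(a) LEMMA 21 is printed with the hypothesis `(2^K - 2) γ₂ₙ₊₁ ≤ 1` and argued node by node:
`|hᵢ| ≤ (1 + γ_{2(n-1)}) γ₂ₙ p̃₁(x) ≤ γ₂ₙ₊₁ p̃₁(x)` for `i ≠ 1`, "therefore
`Σ |hᵢ| ≤ |p₁(x)| + γ₂ₙ (1 + (2^K - 2) γ₂ₙ₊₁) p̃₁(x)`". The summation line carries a factor `γ₂ₙ`
on the non-root terms that the per-node bound does not provide, and `(1 + γ_{2n-2}) γ₂ₙ ≤ γ₂ₙ₊₁`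
itself holds for `u` small against `1/n²` but is not implied by the hypotheses (`K = 2`, `n = 4`,
`u = 1/27` satisfy them and violate it: `(9/7)(8/19) > 1/2`). Summing eq. (10) LEVEL BY LEVEL
instead (`Σ_{level ℓ+1} p̃ ≤ ((1+u)^{2n} - 1) Σ_{level ℓ} p̃`, a geometric series of ratio `< 1/2`
under `4nu < 1`) yields the printed conclusion `|p₁(x)| + γ₄ₙ p̃₁(x)` exactly, with no
hypothesis beyond `4nu < 1` — so `sum_abs_le` carries none.
(b) THEOREM 20: eq. (24) prints the middle `p̃₁`-term as `γ₂ₙ₊₁ γ^K_{2^{K+1}-4}`, whereas the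
printed proof (through LEMMA 21's `γ₄ₙ`) arrives at `γ₄ₙ γ^K_{2^{K+1}-4}`, and that is what
`abs_compHornerK_sub_le_gamma_four` states. The proof's passage from `e₁ + e₂` to its last display
also uses `(u + 3γ²_M) γ₂ₙ γ₄ₙ^{K-1} ≤ γ₄ₙ^{K+1}` silently (it amounts to `(u + 3γ²_M) γ₂ₙ ≤ γ₄ₙ²`,
roughly `3M²u ≤ 8n`, not implied by the hypotheses when `K` is large against `n`); here the
level-wise PROPOSITION 17 (`γ₂ₙ^{K-1}`, a factor `2^{K-1}` below `γ₄ₙ^{K-1}`) absorbs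
`1 + u + 3γ²_M ≤ 2` (`alpha_le_one`, from THEOREM 18's own `4Mu ≤ 1`), so the display holds as
printed and even without its `γ₄ₙ^{K+1}` term. All forms are `u + O(u²)` plus
`((4nu)^K + O(u^{K+1})) cond(p₁, x)`, eq. (22).

NOT formalised here: §§3.3–4 (`CompHorner`, its dynamic bound and faithfulness: they are
`LangloisLouvet2006/CompHorner.lean`, `LangloisLouvet2006/DynamicBound.lean` and
`GraillatJezequelPicot2018/CompHornerDirected.lean`); THEOREM 18 itself (imported:
`GraillatJezequelPicot2018.abs_sumK_sub_sum_le`, `abs_sumK_recSum_sub_sum_le`,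
`abs_sumK_sub_sum_le_of_rd`; [OgitaRumpOishi2005]); the format-level proofs of eq. (4) and
THEOREM 4 and the underflow discussion (hypotheses, resp. the `rd`-model's fiat); the operation
counts; §§5.3, 6.3 and 7 (the choice of `K` against double-double / quad-double, experiments,
timings).
-/

namespace Literature.ComputerArithmetic.GraillatLangloisLouvet2009

open Finset Literature.ComputerArithmetic.Higham2002
open Literature.ComputerArithmetic.LangloisLouvet2006
open Literature.ComputerArithmetic.GraillatJezequelPicot2018

variable {K : Type*} [Field K] [LinearOrder K] [IsStrictOrderedRing K]

/-! ## The binary tree of `EFTHornerK` (Algorithm 15): levels `ℓ = 0 … L`, positions `j < 2^ℓ` -/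

/-- The value at `x` of the polynomial `p_{(ℓ,j)}` sitting at level `ℓ`, position `j` of the
`EFTHornerK` tree whose root `p₁ = p_{(0,0)}` has degree `n = d + L` and whose leaves (level `L`)
have degree `d`: `p_{(ℓ,j)}(x) = Σ_{i ≤ d + (L - ℓ)} A ℓ j i · xⁱ` (node `(ℓ, j)` is the paper's node
`i = 2^ℓ + j ∈ N_T`). [cite: GraillatLangloisLouvet2009, §5.1 Figure 3, eq. (17)] -/
def nodeVal (x : K) (d L : ℕ) (A : ℕ → ℕ → ℕ → K) (ℓ j : ℕ) : K :=
  ∑ i ∈ range (d + (L - ℓ) + 1), A ℓ j i * x ^ i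

/-- `p̃_{(ℓ,j)}(|x|) = Σ_{i ≤ d + (L - ℓ)} |A ℓ j i| · |x|ⁱ`, the absolute polynomial of node `(ℓ, j)`.
[cite: GraillatLangloisLouvet2009, §3.1 eq. (7); §5.2 Proposition 17] -/
def nodeAbs (x : K) (d L : ℕ) (A : ℕ → ℕ → ℕ → K) (ℓ j : ℕ) : K :=
  ∑ i ∈ range (d + (L - ℓ) + 1), |A ℓ j i| * |x| ^ i

/-- ALGORITHM 15 (`EFTHornerK`, the recursive application of `EFTHorner` = Algorithm 6 to `K - 1 = L`
levels) as a TRACE in the rounding-error MODEL. Data: coefficients `A ℓ j i` of the node polynomials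
(root `A 0 0 = p₁` of degree `n = d + L`; node `(ℓ, j)`, `ℓ ≤ L`, `j < 2^ℓ`, has degree `d + (L - ℓ)`),
the `EFTHorner` running values `S ℓ j i` and rounded products `P ℓ j i` of every INTERNAL node
(`ℓ < L`), and the node values `H ℓ j`. Hypotheses, for every internal node `(ℓ, j)` of degree
`D + 1`, `D = d + (L - 1 - ℓ)`: `s_{D+1} = a_{D+1}`; for `i ≤ D` the two error-free transformations of
[GraillatLangloisLouvet2009, §2.2 Theorem 4] — `sᵢ₊₁ · x = pᵢ + πᵢ` (`TwoProd`) and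
`pᵢ + aᵢ = sᵢ + σᵢ` (`TwoSum`) with `|πᵢ| ≤ u |sᵢ₊₁ x|`, `|σᵢ| ≤ u |pᵢ + aᵢ|` — where the error
polynomials ARE the children: `p_π = p_{(ℓ+1, 2j)}`, `p_σ = p_{(ℓ+1, 2j+1)}` (eq. (17)); and
`hᵢ = s₀ = Horner(pᵢ, x)` (Theorem 7 (i)). The LEAF values `H L j` are constrained separately
(`IsLeafHorner`). [cite: GraillatLangloisLouvet2009, §5.1 Algorithm 15, eq. (17); §3.2 Algorithm 6,
Theorem 7] -/
structure IsEFTHornerK (u x : K) (d L : ℕ) (A : ℕ → ℕ → ℕ → K) (S P : ℕ → ℕ → ℕ → K)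
    (H : ℕ → ℕ → K) : Prop where
  top : ∀ ℓ < L, ∀ j < 2 ^ ℓ, S ℓ j (d + (L - 1 - ℓ) + 1) = A ℓ j (d + (L - 1 - ℓ) + 1)
  prod : ∀ ℓ < L, ∀ j < 2 ^ ℓ, ∀ i < d + (L - 1 - ℓ) + 1,
    S ℓ j (i + 1) * x = P ℓ j i + A (ℓ + 1) (2 * j) i
  sum : ∀ ℓ < L, ∀ j < 2 ^ ℓ, ∀ i < d + (L - 1 - ℓ) + 1,
    P ℓ j i + A ℓ j i = S ℓ j i + A (ℓ + 1) (2 * j + 1) i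
  prod_err : ∀ ℓ < L, ∀ j < 2 ^ ℓ, ∀ i < d + (L - 1 - ℓ) + 1,
    |A (ℓ + 1) (2 * j) i| ≤ u * |S ℓ j (i + 1) * x|
  sum_err : ∀ ℓ < L, ∀ j < 2 ^ ℓ, ∀ i < d + (L - 1 - ℓ) + 1,
    |A (ℓ + 1) (2 * j + 1) i| ≤ u * |P ℓ j i + A ℓ j i|
  val : ∀ ℓ < L, ∀ j < 2 ^ ℓ, H ℓ j = S ℓ j 0

/-- ALGORITHM 19, line 2 (`for i ∈ N_L, hᵢ = Horner(pᵢ, x)`) as a TRACE in the rounding-error MODEL: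
every LEAF value `H L j` (`j < 2^L`, degree `d`) is Horner's rule run in the standard model,
`H L j = Higham2002.hornerFl x (A L j) (E j) (Δ j) d` with relative errors `|E j k|, |Δ j k| ≤ u`.
[cite: GraillatLangloisLouvet2009, §6.2 Algorithm 19; §3.1 Algorithm 5, eq. (8)] -/
structure IsLeafHorner (u x : K) (d L : ℕ) (A : ℕ → ℕ → ℕ → K) (H : ℕ → ℕ → K)
    (E Δ : ℕ → ℕ → K) : Prop where
  err_prod : ∀ j < 2 ^ L, ∀ k, |E j k| ≤ u
  err_sum : ∀ j < 2 ^ L, ∀ k, |Δ j k| ≤ u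
  val : ∀ j < 2 ^ L, H L j = hornerFl x (A L j) (E j) (Δ j) d

/-! ## Two bookkeeping lemmas: children come in pairs; the nodes listed in a row -/

omit [LinearOrder K] [IsStrictOrderedRing K] in
/-- The `2M` nodes of a level, grouped by parent: `Σ_{j' < 2M} f j' = Σ_{j < M} (f (2j) + f (2j+1))`.
[cite: GraillatLangloisLouvet2009, §5.1 Figure 3] -/
theorem sum_range_two_mul (f : ℕ → K) :
    ∀ M : ℕ, ∑ j ∈ range (2 * M), f j = ∑ j ∈ range M, (f (2 * j) + f (2 * j + 1))
  | 0 => by simp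
  | M + 1 => by
      rw [show 2 * (M + 1) = 2 * M + 1 + 1 by ring, Finset.sum_range_succ, Finset.sum_range_succ,
        Finset.sum_range_succ, sum_range_two_mul f M, add_assoc]

/-- The node values listed in one row, level after level (node `(ℓ, j)` at position
`t = 2^ℓ - 1 + j`, i.e. the paper's node number `i = t + 1`): `flat H t = H ℓ j` with
`ℓ = ⌊log₂ (t+1)⌋`, `j = t + 1 - 2^ℓ`. This is the vector `(hᵢ)_{i ∈ N_T}` handed to `SumK`.
[cite: GraillatLangloisLouvet2009, §5.1 (index sets `N_T`, `N_I`, `N_L`); §6.2 Algorithm 19] -/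
def flat (H : ℕ → ℕ → K) (t : ℕ) : K :=
  H (Nat.log 2 (t + 1)) (t + 1 - 2 ^ Nat.log 2 (t + 1))

omit [LinearOrder K] [IsStrictOrderedRing K] in
/-- `card N_T = 2^{L+1} - 1` and the row lists every node once:
`Σ_{t < 2^{L+1} - 1} flat H t = Σ_{ℓ ≤ L} Σ_{j < 2^ℓ} H ℓ j`.
[cite: GraillatLangloisLouvet2009, §5.1 (index sets)] -/
theorem sum_flat_eq (H : ℕ → ℕ → K) :
    ∀ L : ℕ, ∑ t ∈ range (2 ^ (L + 1) - 1), flat H t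
      = ∑ ℓ ∈ range (L + 1), ∑ j ∈ range (2 ^ ℓ), H ℓ j
  | 0 => by simp [flat]
  | L + 1 => by
      have h1 : 1 ≤ 2 ^ (L + 1) := Nat.one_le_two_pow
      have hsplit : 2 ^ (L + 1 + 1) - 1 = (2 ^ (L + 1) - 1) + 2 ^ (L + 1) := by
        rw [pow_succ]; omega
      rw [hsplit, Finset.sum_range_add, sum_flat_eq H L, Finset.sum_range_succ _ (L + 1)]
      congr 1
      refine Finset.sum_congr rfl fun j hj => ?_
      have hj' := Finset.mem_range.mp hj
      have ht : 2 ^ (L + 1) - 1 + j + 1 = 2 ^ (L + 1) + j := by omega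
      have hlog : Nat.log 2 (2 ^ (L + 1) + j) = L + 1 :=
        Nat.log_eq_of_pow_le_of_lt_pow (by omega) (by rw [pow_succ]; omega)
      simp only [flat, ht, hlog, Nat.add_sub_cancel_left]

/-! ## THEOREM 16: `EFTHornerK` is an error-free transformation of `p₁(x)` -/

omit [IsStrictOrderedRing K] in
/-- One internal node: eq. (18), `pᵢ(x) = hᵢ + (p₂ᵢ + p₂ᵢ₊₁)(x)` — this is Theorem 7, eq. (9)
(`LangloisLouvet2006.eftHorner_add_sum_eq`) at node `(ℓ, j)`.
[cite: GraillatLangloisLouvet2009, §5.1 eq. (18); §3.2 Theorem 7 eq. (9)] -/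
theorem nodeVal_eq_of_internal {u x : K} {d L : ℕ} {A S P : ℕ → ℕ → ℕ → K} {H : ℕ → ℕ → K}
    (hT : IsEFTHornerK u x d L A S P H) {ℓ : ℕ} (hℓ : ℓ < L) {j : ℕ} (hj : j < 2 ^ ℓ) :
    nodeVal x d L A ℓ j
      = H ℓ j + (nodeVal x d L A (ℓ + 1) (2 * j) + nodeVal x d L A (ℓ + 1) (2 * j + 1)) := by
  have hdeg : d + (L - ℓ) + 1 = d + (L - 1 - ℓ) + 1 + 1 := by omega
  have hdeg' : d + (L - (ℓ + 1)) + 1 = d + (L - 1 - ℓ) + 1 := by omega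
  have key := eftHorner_add_sum_eq x (d + (L - 1 - ℓ) + 1) (A ℓ j) (S ℓ j) (P ℓ j)
    (A (ℓ + 1) (2 * j)) (A (ℓ + 1) (2 * j + 1)) (hT.top ℓ hℓ j hj) (hT.prod ℓ hℓ j hj)
    (hT.sum ℓ hℓ j hj)
  unfold nodeVal
  rw [hdeg, hdeg', ← key, hT.val ℓ hℓ j hj, ← Finset.sum_add_distrib]
  congr 1
  exact Finset.sum_congr rfl fun i _ => by ring

omit [IsStrictOrderedRing K] in
/-- THEOREM 16 level by level: for `m ≤ L`,
`p₁(x) = Σ_{ℓ < m} Σ_{j < 2^ℓ} h_{(ℓ,j)} + Σ_{j < 2^m} p_{(m,j)}(x)` (induction on the depth, the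
"induction step easy to derive using Relations (17) and (18)").
[cite: GraillatLangloisLouvet2009, §5.2 Theorem 16, proof] -/
theorem nodeVal_root_eq_levels {u x : K} {d L : ℕ} {A S P : ℕ → ℕ → ℕ → K} {H : ℕ → ℕ → K}
    (hT : IsEFTHornerK u x d L A S P H) :
    ∀ m ≤ L, nodeVal x d L A 0 0
      = ∑ ℓ ∈ range m, ∑ j ∈ range (2 ^ ℓ), H ℓ j + ∑ j ∈ range (2 ^ m), nodeVal x d L A m j
  | 0, _ => by simp
  | m + 1, hm => by
      rw [nodeVal_root_eq_levels hT m (Nat.le_of_succ_le hm), Finset.sum_range_succ, pow_succ,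
        mul_comm (2 ^ m) 2, sum_range_two_mul]
      have hlev : ∑ j ∈ range (2 ^ m), nodeVal x d L A m j
          = ∑ j ∈ range (2 ^ m), (H m j
              + (nodeVal x d L A (m + 1) (2 * j) + nodeVal x d L A (m + 1) (2 * j + 1))) :=
        Finset.sum_congr rfl fun j hj =>
          nodeVal_eq_of_internal hT (Nat.lt_of_succ_le hm) (Finset.mem_range.mp hj)
      rw [hlev, Finset.sum_add_distrib, add_assoc]

omit [IsStrictOrderedRing K] in
/-- THEOREM 16, eq. (19): `p₁(x) = Σ_{i ∈ N_I} hᵢ + Σ_{i ∈ N_L} pᵢ(x)` — the internal-node values plus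
the EXACT values of the `2^L = 2^{K-1}` leaf polynomials. Pure algebra (no error-size hypothesis is
used). [cite: GraillatLangloisLouvet2009, §5.2 Theorem 16 eq. (19)] -/
theorem eftHornerK_eq {u x : K} {d L : ℕ} {A S P : ℕ → ℕ → ℕ → K} {H : ℕ → ℕ → K}
    (hT : IsEFTHornerK u x d L A S P H) :
    nodeVal x d L A 0 0
      = ∑ ℓ ∈ range L, ∑ j ∈ range (2 ^ ℓ), H ℓ j + ∑ j ∈ range (2 ^ L), nodeVal x d L A L j :=
  nodeVal_root_eq_levels hT L le_rfl

omit [IsStrictOrderedRing K] in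
/-- PROPOSITION 17, the identity in eq. (20): with the leaves evaluated too (`hᵢ = Horner(pᵢ, x)`,
`i ∈ N_L`, or indeed ANY values `H L j`),
`p₁(x) - Σ_{i ∈ N_T} hᵢ = Σ_{i ∈ N_L} (pᵢ(x) - hᵢ)`: the error of the exact sum of ALL node values
is the sum of the leaf evaluation errors. [cite: GraillatLangloisLouvet2009, §5.2 Proposition 17
eq. (20)] -/
theorem nodeVal_root_sub_sum_eq {u x : K} {d L : ℕ} {A S P : ℕ → ℕ → ℕ → K} {H : ℕ → ℕ → K}
    (hT : IsEFTHornerK u x d L A S P H) :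
    nodeVal x d L A 0 0 - ∑ ℓ ∈ range (L + 1), ∑ j ∈ range (2 ^ ℓ), H ℓ j
      = ∑ j ∈ range (2 ^ L), (nodeVal x d L A L j - H L j) := by
  rw [eftHornerK_eq hT, Finset.sum_range_succ, Finset.sum_sub_distrib]
  ring

/-! ## Level by level: eq. (10) summed over the children (the ratio `(1+u)^{2n} - 1 ≤ γ₂ₙ`) -/

/-- The absolute polynomials of one level, summed: `T_ℓ = Σ_{j < 2^ℓ} p̃_{(ℓ,j)}(|x|)`.
[cite: GraillatLangloisLouvet2009, §5.2 Proposition 17; §6.2 Lemma 21] -/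
def levelAbs (x : K) (d L : ℕ) (A : ℕ → ℕ → ℕ → K) (ℓ : ℕ) : K :=
  ∑ j ∈ range (2 ^ ℓ), nodeAbs x d L A ℓ j

omit [IsStrictOrderedRing K] in
/-- `T₀ = p̃₁(|x|)`. [cite: GraillatLangloisLouvet2009, §5.2 Proposition 17] -/
theorem levelAbs_zero (x : K) (d L : ℕ) (A : ℕ → ℕ → ℕ → K) :
    levelAbs x d L A 0 = nodeAbs x d L A 0 0 := by
  simp [levelAbs]

/-- `p̃ ≥ 0`. [cite: GraillatLangloisLouvet2009, §3.1 eq. (7)] -/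
theorem nodeAbs_nonneg (x : K) (d L : ℕ) (A : ℕ → ℕ → ℕ → K) (ℓ j : ℕ) :
    0 ≤ nodeAbs x d L A ℓ j :=
  Finset.sum_nonneg fun _ _ => by positivity

/-- `T_ℓ ≥ 0`. [cite: GraillatLangloisLouvet2009, §5.2 Proposition 17] -/
theorem levelAbs_nonneg (x : K) (d L : ℕ) (A : ℕ → ℕ → ℕ → K) (ℓ : ℕ) :
    0 ≤ levelAbs x d L A ℓ :=
  Finset.sum_nonneg fun _ _ => nodeAbs_nonneg x d L A _ _

/-- `|p_{(ℓ,j)}(x)| ≤ p̃_{(ℓ,j)}(|x|)`. [cite: GraillatLangloisLouvet2009, §3.1 eq. (7)] -/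
theorem abs_nodeVal_le_nodeAbs (x : K) (d L : ℕ) (A : ℕ → ℕ → ℕ → K) (ℓ j : ℕ) :
    |nodeVal x d L A ℓ j| ≤ nodeAbs x d L A ℓ j :=
  abs_sum_le_sum_abs_mul_abs_pow _ _ _

/-- eq. (10) at one internal node `(ℓ, j)` of degree `D + 1`, `D = d + (L-1-ℓ)` (Theorem 7, i.e.
`LangloisLouvet2006.sum_abs_pi_add_abs_sigma_le`, product form): the two children satisfy
`p̃_{(ℓ+1,2j)}(|x|) + p̃_{(ℓ+1,2j+1)}(|x|) ≤ ((1+u)^{2(D+1)} - 1) · p̃_{(ℓ,j)}(|x|)`.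
[cite: GraillatLangloisLouvet2009, §3.2 Theorem 7 eq. (10); §5.1 eq. (17)] -/
theorem nodeAbs_children_le {u x : K} (hu : 0 ≤ u) {d L : ℕ} {A S P : ℕ → ℕ → ℕ → K}
    {H : ℕ → ℕ → K} (hT : IsEFTHornerK u x d L A S P H) {ℓ : ℕ} (hℓ : ℓ < L) {j : ℕ}
    (hj : j < 2 ^ ℓ) :
    nodeAbs x d L A (ℓ + 1) (2 * j) + nodeAbs x d L A (ℓ + 1) (2 * j + 1)
      ≤ ((1 + u) ^ (2 * (d + (L - 1 - ℓ) + 1)) - 1) * nodeAbs x d L A ℓ j := by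
  have hdeg : d + (L - ℓ) + 1 = d + (L - 1 - ℓ) + 1 + 1 := by omega
  have hdeg' : d + (L - (ℓ + 1)) + 1 = d + (L - 1 - ℓ) + 1 := by omega
  have key := sum_abs_pi_add_abs_sigma_le hu x (d + (L - 1 - ℓ) + 1) (A ℓ j) (S ℓ j) (P ℓ j)
    (A (ℓ + 1) (2 * j)) (A (ℓ + 1) (2 * j + 1)) (hT.top ℓ hℓ j hj) (hT.prod ℓ hℓ j hj)
    (hT.sum ℓ hℓ j hj) (hT.prod_err ℓ hℓ j hj) (hT.sum_err ℓ hℓ j hj)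
  unfold nodeAbs
  rw [hdeg, hdeg', ← Finset.sum_add_distrib]
  refine le_trans (le_of_eq (Finset.sum_congr rfl fun i _ => ?_)) key
  ring

/-- eq. (10) summed over a level: `T_{ℓ+1} ≤ ((1+u)^{2n} - 1) · T_ℓ` for `ℓ < L` (`n = d + L`; every
node of level `ℓ` has degree `≤ n`). [cite: GraillatLangloisLouvet2009, §5.2 Proposition 17, proof
("see [14]"); §3.2 Theorem 7 eq. (10)] -/
theorem levelAbs_succ_le {u x : K} (hu : 0 ≤ u) {d L : ℕ} {A S P : ℕ → ℕ → ℕ → K}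
    {H : ℕ → ℕ → K} (hT : IsEFTHornerK u x d L A S P H) {ℓ : ℕ} (hℓ : ℓ < L) :
    levelAbs x d L A (ℓ + 1) ≤ ((1 + u) ^ (2 * (d + L)) - 1) * levelAbs x d L A ℓ := by
  unfold levelAbs
  rw [pow_succ, mul_comm (2 ^ ℓ) 2, sum_range_two_mul, Finset.mul_sum]
  refine Finset.sum_le_sum fun j hj => le_trans (nodeAbs_children_le hu hT hℓ (mem_range.mp hj))
    (mul_le_mul_of_nonneg_right ?_ (nodeAbs_nonneg x d L A ℓ j))
  have h1 : (1 : K) ≤ 1 + u := by linarith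
  have := pow_le_pow_right₀ h1 (show 2 * (d + (L - 1 - ℓ) + 1) ≤ 2 * (d + L) by omega)
  linarith

/-- Hence `T_ℓ ≤ ((1+u)^{2n} - 1)^ℓ · p̃₁(|x|)` for `ℓ ≤ L`; in particular the leaves satisfy
`Σ_{i ∈ N_L} p̃ᵢ ≤ ((1+u)^{2n} - 1)^{K-1} p̃₁ ≤ γ₂ₙ^{K-1} p̃₁`.
[cite: GraillatLangloisLouvet2009, §5.2 Proposition 17, proof ("see [14]")] -/
theorem levelAbs_le_pow {u x : K} (hu : 0 ≤ u) {d L : ℕ} {A S P : ℕ → ℕ → ℕ → K}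
    {H : ℕ → ℕ → K} (hT : IsEFTHornerK u x d L A S P H) :
    ∀ ℓ ≤ L, levelAbs x d L A ℓ ≤ ((1 + u) ^ (2 * (d + L)) - 1) ^ ℓ * nodeAbs x d L A 0 0
  | 0, _ => by rw [levelAbs_zero, pow_zero, one_mul]
  | ℓ + 1, hℓ => by
      have hG0 : 0 ≤ (1 + u) ^ (2 * (d + L)) - 1 := by
        have := one_le_pow₀ (M₀ := K) (a := 1 + u) (by linarith) (n := 2 * (d + L))
        linarith
      calc levelAbs x d L A (ℓ + 1) ≤ ((1 + u) ^ (2 * (d + L)) - 1) * levelAbs x d L A ℓ :=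
            levelAbs_succ_le hu hT (Nat.lt_of_succ_le hℓ)
        _ ≤ ((1 + u) ^ (2 * (d + L)) - 1)
              * (((1 + u) ^ (2 * (d + L)) - 1) ^ ℓ * nodeAbs x d L A 0 0) :=
            mul_le_mul_of_nonneg_left (levelAbs_le_pow hu hT ℓ (Nat.le_of_succ_le hℓ)) hG0
        _ = ((1 + u) ^ (2 * (d + L)) - 1) ^ (ℓ + 1) * nodeAbs x d L A 0 0 := by ring

/-! ## PROPOSITION 17: the a priori bound on `|p₁(x) - Σ_{i ∈ N_T} hᵢ|` -/

/-- One leaf: `|pᵢ(x) - hᵢ| ≤ ((1+u)^{2d} - 1) p̃ᵢ(|x|)` (Horner's rule bound (8) in product form,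
`Higham2002.abs_hornerFl_sub_sum_le`, degree `d = n - K + 1`).
[cite: GraillatLangloisLouvet2009, §3.1 eq. (8); §6.2 Algorithm 19] -/
theorem abs_leaf_sub_le {u x : K} (hu : 0 ≤ u) {d L : ℕ} {A : ℕ → ℕ → ℕ → K} {H : ℕ → ℕ → K}
    {E Δ : ℕ → ℕ → K} (hLf : IsLeafHorner u x d L A H E Δ) {j : ℕ} (hj : j < 2 ^ L) :
    |nodeVal x d L A L j - H L j| ≤ ((1 + u) ^ (2 * d) - 1) * nodeAbs x d L A L j := by
  unfold nodeVal nodeAbs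
  rw [Nat.sub_self, add_zero, abs_sub_comm, hLf.val j hj]
  exact abs_hornerFl_sub_sum_le hu x d (A L j) (E j) (Δ j) (hLf.err_prod j hj) (hLf.err_sum j hj)

/-- PROPOSITION 17, eq. (20), product form: with the leaves evaluated by Horner's rule,
`|p₁(x) - Σ_{i ∈ N_T} hᵢ| ≤ ((1+u)^{2d} - 1) · ((1+u)^{2n} - 1)^{L} · p̃₁(|x|)`
(`d = n - K + 1` the leaf degree, `L = K - 1` levels).
[cite: GraillatLangloisLouvet2009, §5.2 Proposition 17 eq. (20)] -/
theorem abs_nodeVal_root_sub_sum_le {u x : K} (hu : 0 ≤ u) {d L : ℕ} {A S P : ℕ → ℕ → ℕ → K}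
    {H : ℕ → ℕ → K} {E Δ : ℕ → ℕ → K} (hT : IsEFTHornerK u x d L A S P H)
    (hLf : IsLeafHorner u x d L A H E Δ) :
    |nodeVal x d L A 0 0 - ∑ ℓ ∈ range (L + 1), ∑ j ∈ range (2 ^ ℓ), H ℓ j|
      ≤ ((1 + u) ^ (2 * d) - 1) * ((1 + u) ^ (2 * (d + L)) - 1) ^ L * nodeAbs x d L A 0 0 := by
  rw [nodeVal_root_sub_sum_eq hT]
  have hF0 : 0 ≤ (1 + u) ^ (2 * d) - 1 := by
    have := one_le_pow₀ (M₀ := K) (a := 1 + u) (by linarith) (n := 2 * d)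
    linarith
  calc |∑ j ∈ range (2 ^ L), (nodeVal x d L A L j - H L j)|
      ≤ ∑ j ∈ range (2 ^ L), |nodeVal x d L A L j - H L j| := Finset.abs_sum_le_sum_abs _ _
    _ ≤ ∑ j ∈ range (2 ^ L), ((1 + u) ^ (2 * d) - 1) * nodeAbs x d L A L j :=
        Finset.sum_le_sum fun j hj => abs_leaf_sub_le hu hLf (mem_range.mp hj)
    _ = ((1 + u) ^ (2 * d) - 1) * levelAbs x d L A L := by rw [← Finset.mul_sum]; rfl
    _ ≤ ((1 + u) ^ (2 * d) - 1) * (((1 + u) ^ (2 * (d + L)) - 1) ^ L * nodeAbs x d L A 0 0) :=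
        mul_le_mul_of_nonneg_left (levelAbs_le_pow hu hT L le_rfl) hF0
    _ = ((1 + u) ^ (2 * d) - 1) * ((1 + u) ^ (2 * (d + L)) - 1) ^ L * nodeAbs x d L A 0 0 := by
        ring

/-- PROPOSITION 17, eq. (20), `γ` form, as the level argument gives it: with `2n u < 1`,
`|p₁(x) - Σ_{i ∈ N_T} hᵢ| ≤ γ_{2d} · γ₂ₙ^{L} · p̃₁(|x|) = γ_{2(n-K+1)} γ₂ₙ^{K-1} p̃₁(x)`
(SHARPER than the print, which has `γ₄ₙ^{K-1}`).
[cite: GraillatLangloisLouvet2009, §5.2 Proposition 17 eq. (20)] -/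
theorem abs_nodeVal_root_sub_sum_le_gamma {u x : K} (hu : 0 ≤ u) {d L : ℕ}
    (hn : ((2 * (d + L) : ℕ) : K) * u < 1) {A S P : ℕ → ℕ → ℕ → K} {H : ℕ → ℕ → K}
    {E Δ : ℕ → ℕ → K} (hT : IsEFTHornerK u x d L A S P H) (hLf : IsLeafHorner u x d L A H E Δ) :
    |nodeVal x d L A 0 0 - ∑ ℓ ∈ range (L + 1), ∑ j ∈ range (2 ^ ℓ), H ℓ j|
      ≤ gamma u (2 * d) * gamma u (2 * (d + L)) ^ L * nodeAbs x d L A 0 0 := by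
  have hd : ((2 * d : ℕ) : K) * u < 1 := by
    refine lt_of_le_of_lt (mul_le_mul_of_nonneg_right ?_ hu) hn
    exact_mod_cast (show 2 * d ≤ 2 * (d + L) by omega)
  have hF0 : 0 ≤ (1 + u) ^ (2 * d) - 1 := by
    have := one_le_pow₀ (M₀ := K) (a := 1 + u) (by linarith) (n := 2 * d)
    linarith
  have hG0 : 0 ≤ (1 + u) ^ (2 * (d + L)) - 1 := by
    have := one_le_pow₀ (M₀ := K) (a := 1 + u) (by linarith) (n := 2 * (d + L))
    linarith
  have hF := one_add_pow_sub_one_le_gamma hu hd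
  have hG := one_add_pow_sub_one_le_gamma hu hn
  refine le_trans (abs_nodeVal_root_sub_sum_le hu hT hLf) (mul_le_mul_of_nonneg_right
    (mul_le_mul hF (pow_le_pow_left₀ hG0 hG L) (pow_nonneg hG0 L) (gamma_nonneg hu hd))
    (nodeAbs_nonneg x d L A 0 0))

/-- PROPOSITION 17, eq. (20) AS PRINTED: with `4n u < 1`,
`|p₁(x) - Σ_{i ∈ N_T} hᵢ| ≤ γ_{2(n-K+1)} γ₄ₙ^{K-1} p̃₁(x)` (from the previous bound by `γ₂ₙ ≤ γ₄ₙ`).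
[cite: GraillatLangloisLouvet2009, §5.2 Proposition 17 eq. (20)] -/
theorem abs_nodeVal_root_sub_sum_le_gamma_four {u x : K} (hu : 0 ≤ u) {d L : ℕ}
    (hn4 : ((4 * (d + L) : ℕ) : K) * u < 1) {A S P : ℕ → ℕ → ℕ → K} {H : ℕ → ℕ → K}
    {E Δ : ℕ → ℕ → K} (hT : IsEFTHornerK u x d L A S P H) (hLf : IsLeafHorner u x d L A H E Δ) :
    |nodeVal x d L A 0 0 - ∑ ℓ ∈ range (L + 1), ∑ j ∈ range (2 ^ ℓ), H ℓ j|
      ≤ gamma u (2 * d) * gamma u (4 * (d + L)) ^ L * nodeAbs x d L A 0 0 := by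
  have hn : ((2 * (d + L) : ℕ) : K) * u < 1 := by
    refine lt_of_le_of_lt (mul_le_mul_of_nonneg_right ?_ hu) hn4
    exact_mod_cast (show 2 * (d + L) ≤ 4 * (d + L) by omega)
  have hd : ((2 * d : ℕ) : K) * u < 1 := by
    refine lt_of_le_of_lt (mul_le_mul_of_nonneg_right ?_ hu) hn
    exact_mod_cast (show 2 * d ≤ 2 * (d + L) by omega)
  have h24 : gamma u (2 * (d + L)) ≤ gamma u (4 * (d + L)) := gamma_mono hu (by omega) hn4
  exact le_trans (abs_nodeVal_root_sub_sum_le_gamma hu hn hT hLf) (mul_le_mul_of_nonneg_right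
    (mul_le_mul_of_nonneg_left (pow_le_pow_left₀ (gamma_nonneg hu hn) h24 L) (gamma_nonneg hu hd))
    (nodeAbs_nonneg x d L A 0 0))

/-! ## LEMMA 21: `Σ_{i ∈ N_T} |hᵢ| ≤ |p₁(x)| + γ₄ₙ p̃₁(x)` -/

/-- `|(p_π + p_σ)(x)| ≤ (p̃_π + p̃_σ)(|x|)`: `|Σ_{i<m} (πᵢ + σᵢ) xⁱ| ≤ Σ_{i<m} (|πᵢ| + |σᵢ|) |x|ⁱ`.
[cite: GraillatLangloisLouvet2009, §3.1 eq. (7)] -/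
theorem abs_sum_add_mul_pow_le (π σ : ℕ → K) (x : K) (m : ℕ) :
    |∑ i ∈ range m, (π i + σ i) * x ^ i| ≤ ∑ i ∈ range m, (|π i| + |σ i|) * |x| ^ i := by
  refine le_trans (Finset.abs_sum_le_sum_abs _ _) (Finset.sum_le_sum fun i _ => ?_)
  rw [abs_mul, abs_pow]
  exact mul_le_mul_of_nonneg_right (abs_add_le _ _) (pow_nonneg (abs_nonneg x) i)

/-- Every node value is Horner's rule on its polynomial, with the (8)/(10)-type bound in product form:
for `ℓ ≤ L`, `j < 2^ℓ`, `|p_{(ℓ,j)}(x) - h_{(ℓ,j)}| ≤ ((1+u)^{2·deg} - 1) p̃_{(ℓ,j)}(|x|)`,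
`deg = d + (L - ℓ)` (internal node: `pᵢ(x) - hᵢ = (p₂ᵢ + p₂ᵢ₊₁)(x)` by (18) and Theorem 7 (10);
leaf: (8)). This is the ingredient "`|hᵢ| ≤ |pᵢ(x)| + γ_{2 deg} p̃ᵢ(x)`" of the proof of Lemma 21.
[cite: GraillatLangloisLouvet2009, §6.2 Lemma 21, proof; §3.2 Theorem 7; §3.1 eq. (8)] -/
theorem abs_nodeVal_sub_le {u x : K} (hu : 0 ≤ u) {d L : ℕ} {A S P : ℕ → ℕ → ℕ → K}
    {H : ℕ → ℕ → K} {E Δ : ℕ → ℕ → K} (hT : IsEFTHornerK u x d L A S P H)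
    (hLf : IsLeafHorner u x d L A H E Δ) {ℓ : ℕ} (hℓ : ℓ ≤ L) {j : ℕ} (hj : j < 2 ^ ℓ) :
    |nodeVal x d L A ℓ j - H ℓ j| ≤ ((1 + u) ^ (2 * (d + (L - ℓ))) - 1) * nodeAbs x d L A ℓ j := by
  rcases lt_or_eq_of_le hℓ with hlt | rfl
  · have hdeg : d + (L - ℓ) + 1 = d + (L - 1 - ℓ) + 1 + 1 := by omega
    have hexp : 2 * (d + (L - ℓ)) = 2 * (d + (L - 1 - ℓ) + 1) := by omega
    have key := eftHorner_add_sum_eq x (d + (L - 1 - ℓ) + 1) (A ℓ j) (S ℓ j) (P ℓ j) _ _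
      (hT.top ℓ hlt j hj) (hT.prod ℓ hlt j hj) (hT.sum ℓ hlt j hj)
    have size := sum_abs_pi_add_abs_sigma_le hu x (d + (L - 1 - ℓ) + 1) (A ℓ j) (S ℓ j) (P ℓ j)
      _ _ (hT.top ℓ hlt j hj) (hT.prod ℓ hlt j hj) (hT.sum ℓ hlt j hj) (hT.prod_err ℓ hlt j hj)
      (hT.sum_err ℓ hlt j hj)
    have hc := abs_sum_add_mul_pow_le (A (ℓ + 1) (2 * j)) (A (ℓ + 1) (2 * j + 1)) x
      (d + (L - 1 - ℓ) + 1)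
    unfold nodeVal nodeAbs
    rw [hdeg, hexp, hT.val ℓ hlt j hj, ← key, add_sub_cancel_left]
    exact le_trans hc size
  · rw [Nat.sub_self, add_zero]
    exact abs_leaf_sub_le hu hLf hj

/-- "`|h₁| ≤ |p₁(x)| + γ₂ₙ p̃₁(x)`" (first line of the proof of Lemma 21), product form:
`|h₁| ≤ |p₁(x)| + ((1+u)^{2n} - 1) p̃₁(|x|)`.
[cite: GraillatLangloisLouvet2009, §6.2 Lemma 21, proof] -/
theorem abs_root_le {u x : K} (hu : 0 ≤ u) {d L : ℕ} {A S P : ℕ → ℕ → ℕ → K} {H : ℕ → ℕ → K}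
    {E Δ : ℕ → ℕ → K} (hT : IsEFTHornerK u x d L A S P H) (hLf : IsLeafHorner u x d L A H E Δ) :
    |H 0 0| ≤ |nodeVal x d L A 0 0| + ((1 + u) ^ (2 * (d + L)) - 1) * nodeAbs x d L A 0 0 := by
  have hb := abs_nodeVal_sub_le hu hT hLf (Nat.zero_le L) (j := 0) (by norm_num)
  rw [Nat.sub_zero] at hb
  have := abs_sub_abs_le_abs_sub (H 0 0) (nodeVal x d L A 0 0)
  rw [abs_sub_comm] at this
  linarith

/-- "for `i ∈ N_T - {1}`, `|hᵢ| ≤ |pᵢ(x)| + γ_{2(n-1)} p̃ᵢ(x) ≤ (1 + γ_{2(n-1)}) p̃ᵢ(x)`" (proof of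
Lemma 21), product form: for a node of level `ℓ + 1 ≤ L` (degree `≤ n - 1`),
`|h_{(ℓ+1,j)}| ≤ (1+u)^{2(n-1)} p̃_{(ℓ+1,j)}(|x|)`.
[cite: GraillatLangloisLouvet2009, §6.2 Lemma 21, proof] -/
theorem abs_nonroot_le {u x : K} (hu : 0 ≤ u) {d L : ℕ} {A S P : ℕ → ℕ → ℕ → K} {H : ℕ → ℕ → K}
    {E Δ : ℕ → ℕ → K} (hT : IsEFTHornerK u x d L A S P H) (hLf : IsLeafHorner u x d L A H E Δ)
    {ℓ : ℕ} (hℓ : ℓ < L) {j : ℕ} (hj : j < 2 ^ (ℓ + 1)) :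
    |H (ℓ + 1) j| ≤ (1 + u) ^ (2 * (d + L - 1)) * nodeAbs x d L A (ℓ + 1) j := by
  have hb := abs_nodeVal_sub_le hu hT hLf (Nat.succ_le_of_lt hℓ) hj
  have hp := abs_nodeVal_le_nodeAbs x d L A (ℓ + 1) j
  have hN := nodeAbs_nonneg x d L A (ℓ + 1) j
  have h1 : (1 : K) ≤ 1 + u := by linarith
  have hmono : (1 + u) ^ (2 * (d + (L - (ℓ + 1)))) ≤ (1 + u) ^ (2 * (d + L - 1)) :=
    pow_le_pow_right₀ h1 (by omega)
  have := abs_sub_abs_le_abs_sub (H (ℓ + 1) j) (nodeVal x d L A (ℓ + 1) j)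
  rw [abs_sub_comm] at this
  nlinarith [mul_le_mul_of_nonneg_right hmono hN]

omit [LinearOrder K] [IsStrictOrderedRing K] in
/-- Bookkeeping for the levels: for `f ≥ 0`, `Σ_{ℓ<L} f ℓ ≤ f 0 + Σ_{ℓ<L} f (ℓ+1)`.
[cite: GraillatLangloisLouvet2009, §6.2 Lemma 21, proof] -/
theorem sum_range_le_head_add_sum_succ {K' : Type*} [AddCommMonoid K'] [PartialOrder K']
    [IsOrderedAddMonoid K'] (f : ℕ → K') (hf : ∀ i, 0 ≤ f i) :
    ∀ L : ℕ, ∑ ℓ ∈ range L, f ℓ ≤ f 0 + ∑ ℓ ∈ range L, f (ℓ + 1)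
  | 0 => by simpa using hf 0
  | L + 1 => by
      rw [Finset.sum_range_succ' f L, Finset.sum_range_succ _ L, add_comm (∑ ℓ ∈ range L, f (ℓ + 1))]
      exact add_le_add le_rfl (le_add_of_nonneg_right (hf (L + 1)))

/-- The real-number heart of Lemma 21 (our level-geometric replacement for the printed count of
nodes): if `G (1 - a) ≤ a` (`G = (1+u)^{2n} - 1 ≤ γ₂ₙ`, `a = 2nu`), `c ≤ 1 + G`
(`c = (1+u)^{2(n-1)}`), `R ≤ G (T + R)` (`R = Σ_{ℓ ≥ 1} T_ℓ`, from `T_{ℓ+1} ≤ G T_ℓ`) and `2a < 1`,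
then `G T + c R ≤ (2a / (1 - 2a)) T = γ₄ₙ T` — with equality in the worst case, so `γ₄ₙ` is
exactly what the tree gives. [cite: GraillatLangloisLouvet2009, §6.2 Lemma 21] -/
theorem root_add_rest_le {a c G R T : K} (ha0 : 0 ≤ a) (h2a : 2 * a < 1) (hc0 : 0 ≤ c)
    (hc1 : c ≤ 1 + G) (hGa : G * (1 - a) ≤ a) (hR0 : 0 ≤ R) (hR : R ≤ G * (T + R))
    (hT : 0 ≤ T) : G * T + c * R ≤ 2 * a / (1 - 2 * a) * T := by
  have h1a : 0 < 1 - a := by linarith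
  have h12a : 0 < 1 - 2 * a := by linarith
  rw [div_mul_eq_mul_div, le_div_iff₀ h12a]
  have h3 : R * (1 - a) ≤ G * (T + R) * (1 - a) := mul_le_mul_of_nonneg_right hR h1a.le
  have h4 : (T + R) * (G * (1 - a)) ≤ (T + R) * a :=
    mul_le_mul_of_nonneg_left hGa (add_nonneg hT hR0)
  have hA : R * (1 - 2 * a) ≤ a * T := by linear_combination h3 + h4
  have h5 : T * (G * (1 - a)) ≤ T * a := mul_le_mul_of_nonneg_left hGa hT
  have h6 : c * (R * (1 - 2 * a)) ≤ c * (a * T) := mul_le_mul_of_nonneg_left hA hc0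
  have h7 : a * T * c ≤ a * T * (1 + G) := mul_le_mul_of_nonneg_left hc1 (mul_nonneg ha0 hT)
  linear_combination h5 + h6 + h7

/-- `Σ_{ℓ<L} T_{ℓ+1} ≤ ((1+u)^{2n} - 1) · (p̃₁(|x|) + Σ_{ℓ<L} T_{ℓ+1})` (eq. (10) level by level).
[cite: GraillatLangloisLouvet2009, §6.2 Lemma 21, proof ("p̃ᵢ(x) ≤ γ₂ₙ p̃₁(x)")] -/
theorem rest_le {u x : K} (hu : 0 ≤ u) {d L : ℕ} {A S P : ℕ → ℕ → ℕ → K} {H : ℕ → ℕ → K}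
    (hT : IsEFTHornerK u x d L A S P H) :
    ∑ ℓ ∈ range L, levelAbs x d L A (ℓ + 1)
      ≤ ((1 + u) ^ (2 * (d + L)) - 1)
        * (nodeAbs x d L A 0 0 + ∑ ℓ ∈ range L, levelAbs x d L A (ℓ + 1)) := by
  have hG0 : 0 ≤ (1 + u) ^ (2 * (d + L)) - 1 := by
    have := one_le_pow₀ (M₀ := K) (a := 1 + u) (by linarith) (n := 2 * (d + L))
    linarith
  have hhead := sum_range_le_head_add_sum_succ (levelAbs x d L A) (levelAbs_nonneg x d L A) L
  rw [levelAbs_zero] at hhead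
  calc ∑ ℓ ∈ range L, levelAbs x d L A (ℓ + 1)
      ≤ ∑ ℓ ∈ range L, ((1 + u) ^ (2 * (d + L)) - 1) * levelAbs x d L A ℓ :=
        Finset.sum_le_sum fun ℓ hℓ => levelAbs_succ_le hu hT (mem_range.mp hℓ)
    _ = ((1 + u) ^ (2 * (d + L)) - 1) * ∑ ℓ ∈ range L, levelAbs x d L A ℓ := by
        rw [Finset.mul_sum]
    _ ≤ ((1 + u) ^ (2 * (d + L)) - 1)
          * (nodeAbs x d L A 0 0 + ∑ ℓ ∈ range L, levelAbs x d L A (ℓ + 1)) :=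
        mul_le_mul_of_nonneg_left hhead hG0

/-- LEMMA 21: with `4nu < 1` (`n = d + L` the degree of `p₁`),
`Σ_{i ∈ N_T} |hᵢ| ≤ |p₁(x)| + γ₄ₙ p̃₁(x)`.
The printed hypothesis `(2^K - 2) γ₂ₙ₊₁ ≤ 1` is NOT needed: instead of bounding each of the
`2^K - 2` non-root nodes by `γ₂ₙ₊₁ p̃₁` we sum eq. (10) level by level (`T_{ℓ+1} ≤ ((1+u)^{2n}-1) T_ℓ`,
a geometric series of ratio `< 1` under `4nu < 1`), which lands exactly on `γ₄ₙ`
(`root_add_rest_le`). [cite: GraillatLangloisLouvet2009, §6.2 Lemma 21] -/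
theorem sum_abs_le {u x : K} (hu : 0 ≤ u) {d L : ℕ} (hn4 : ((4 * (d + L) : ℕ) : K) * u < 1)
    {A S P : ℕ → ℕ → ℕ → K} {H : ℕ → ℕ → K} {E Δ : ℕ → ℕ → K} (hT : IsEFTHornerK u x d L A S P H)
    (hLf : IsLeafHorner u x d L A H E Δ) :
    ∑ ℓ ∈ range (L + 1), ∑ j ∈ range (2 ^ ℓ), |H ℓ j|
      ≤ |nodeVal x d L A 0 0| + gamma u (4 * (d + L)) * nodeAbs x d L A 0 0 := by
  have h1 : (1 : K) ≤ 1 + u := by linarith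
  -- the constants of `root_add_rest_le`
  have ha0 : 0 ≤ ((2 * (d + L) : ℕ) : K) * u := by positivity
  have h2a : 2 * (((2 * (d + L) : ℕ) : K) * u) < 1 := by push_cast at hn4 ⊢; linarith
  have hc0 : 0 ≤ (1 + u) ^ (2 * (d + L - 1)) := by positivity
  have hc1 : (1 + u) ^ (2 * (d + L - 1)) ≤ 1 + ((1 + u) ^ (2 * (d + L)) - 1) := by
    have := pow_le_pow_right₀ h1 (show 2 * (d + L - 1) ≤ 2 * (d + L) by omega)
    linarith
  have hGa : ((1 + u) ^ (2 * (d + L)) - 1) * (1 - ((2 * (d + L) : ℕ) : K) * u)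
      ≤ ((2 * (d + L) : ℕ) : K) * u := by
    have := one_add_pow_mul_one_sub_le hu (2 * (d + L))
    linarith
  have hR0 : 0 ≤ ∑ ℓ ∈ range L, levelAbs x d L A (ℓ + 1) :=
    Finset.sum_nonneg fun ℓ _ => levelAbs_nonneg x d L A (ℓ + 1)
  have hT0 := nodeAbs_nonneg x d L A 0 0
  have hkey := root_add_rest_le ha0 h2a hc0 hc1 hGa hR0 (rest_le hu hT) hT0
  have hγ : gamma u (4 * (d + L))
      = 2 * (((2 * (d + L) : ℕ) : K) * u) / (1 - 2 * (((2 * (d + L) : ℕ) : K) * u)) := by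
    unfold gamma; push_cast; ring
  -- split off the root and bound the rest level by level
  rw [Finset.sum_range_succ' (fun ℓ => ∑ j ∈ range (2 ^ ℓ), |H ℓ j|) L]
  simp only [pow_zero, Finset.sum_range_one]
  have hroot := abs_root_le hu hT hLf
  have hrest : ∑ ℓ ∈ range L, ∑ j ∈ range (2 ^ (ℓ + 1)), |H (ℓ + 1) j|
      ≤ (1 + u) ^ (2 * (d + L - 1)) * ∑ ℓ ∈ range L, levelAbs x d L A (ℓ + 1) := by
    rw [Finset.mul_sum]
    refine Finset.sum_le_sum fun ℓ hℓ => ?_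
    unfold levelAbs
    rw [Finset.mul_sum]
    exact Finset.sum_le_sum fun j hj =>
      abs_nonroot_le hu hT hLf (mem_range.mp hℓ) (mem_range.mp hj)
  rw [hγ]
  linarith

/-- LEMMA 21 through the row enumeration handed to `SumK`: `s̃ = Σ_{t < 2^K - 1} |flat h t|
≤ |p₁(x)| + γ₄ₙ p̃₁(x)`. [cite: GraillatLangloisLouvet2009, §6.2 Lemma 21; proof of Theorem 20] -/
theorem sum_abs_flat_le {u x : K} (hu : 0 ≤ u) {d L : ℕ} (hn4 : ((4 * (d + L) : ℕ) : K) * u < 1)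
    {A S P : ℕ → ℕ → ℕ → K} {H : ℕ → ℕ → K} {E Δ : ℕ → ℕ → K} (hT : IsEFTHornerK u x d L A S P H)
    (hLf : IsLeafHorner u x d L A H E Δ) :
    ∑ t ∈ range (2 ^ (L + 1) - 1), |flat H t|
      ≤ |nodeVal x d L A 0 0| + gamma u (4 * (d + L)) * nodeAbs x d L A 0 0 := by
  have e := sum_flat_eq (fun ℓ j => |H ℓ j|) L
  exact le_of_eq_of_le e (sum_abs_le hu hn4 hT hLf)

/-! ## THEOREM 20: the a priori bound for `CompHornerK` -/

/-- THEOREM 20, SHARP MODEL FORM (the proof's chain `|r̄ - p₁(x)| ≤ e₁ + e₂` before any `γ`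
simplification). Data: an `EFTHornerK` trace with Horner leaves (Algorithm 19, lines 1–2) and a
result `res` of the final summation satisfying THEOREM 18's bound (23) on the row `z = (hᵢ)_{i ∈ N_T}`
of `2^K - 1` values: `|res - s| ≤ (u + 3γ²_M)|s| + γ₂ₘ^K s̃`, `M = 2^K - 2`, `s = Σ zᵢ`, `s̃ = Σ |zᵢ|`
(taken as a HYPOTHESIS here; `abs_compHornerK_sub_le_of_sumK` discharges it from a `SumK` trace).
Conclusion (`n = d + L`, `K = L + 1`, `4nu < 1`, `2Mu < 1`):
`|res - p₁(x)| ≤ (u + 3γ²_M + γ₂ₘ^K)|p₁(x)| + ((1 + u + 3γ²_M) γ_{2d} γ₂ₙ^{K-1} + γ₄ₙ γ₂ₘ^K) p̃₁(x)`.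
[cite: GraillatLangloisLouvet2009, §6.2 Theorem 20, proof; §6.1 Theorem 18 eq. (23)] -/
theorem abs_compHornerK_sub_le {u x : K} (hu : 0 ≤ u) {d L : ℕ}
    (hn4 : ((4 * (d + L) : ℕ) : K) * u < 1) (hM : ((2 * (2 ^ (L + 1) - 2) : ℕ) : K) * u < 1)
    {A S P : ℕ → ℕ → ℕ → K} {H : ℕ → ℕ → K} {E Δ : ℕ → ℕ → K} (hT : IsEFTHornerK u x d L A S P H)
    (hLf : IsLeafHorner u x d L A H E Δ) {res : K}
    (hres : |res - ∑ t ∈ range (2 ^ (L + 1) - 1), flat H t|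
      ≤ (u + 3 * gamma u (2 ^ (L + 1) - 2) ^ 2) * |∑ t ∈ range (2 ^ (L + 1) - 1), flat H t|
        + gamma u (2 * (2 ^ (L + 1) - 2)) ^ (L + 1) * ∑ t ∈ range (2 ^ (L + 1) - 1), |flat H t|) :
    |res - nodeVal x d L A 0 0|
      ≤ (u + 3 * gamma u (2 ^ (L + 1) - 2) ^ 2 + gamma u (2 * (2 ^ (L + 1) - 2)) ^ (L + 1))
          * |nodeVal x d L A 0 0|
        + ((1 + u + 3 * gamma u (2 ^ (L + 1) - 2) ^ 2) * (gamma u (2 * d) * gamma u (2 * (d + L)) ^ L)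
            + gamma u (4 * (d + L)) * gamma u (2 * (2 ^ (L + 1) - 2)) ^ (L + 1))
          * nodeAbs x d L A 0 0 := by
  have hn : ((2 * (d + L) : ℕ) : K) * u < 1 := by
    refine lt_of_le_of_lt (mul_le_mul_of_nonneg_right ?_ hu) hn4
    exact_mod_cast (show 2 * (d + L) ≤ 4 * (d + L) by omega)
  set p₁ := nodeVal x d L A 0 0
  set pt := nodeAbs x d L A 0 0
  set s := ∑ t ∈ range (2 ^ (L + 1) - 1), flat H t
  set α := u + 3 * gamma u (2 ^ (L + 1) - 2) ^ 2
  set β := gamma u (2 * (2 ^ (L + 1) - 2)) ^ (L + 1)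
  set B := gamma u (2 * d) * gamma u (2 * (d + L)) ^ L
  have hα : 0 ≤ α := by positivity
  have hβ : 0 ≤ β := pow_nonneg (gamma_nonneg hu hM) _
  have hs : s = ∑ ℓ ∈ range (L + 1), ∑ j ∈ range (2 ^ ℓ), H ℓ j := sum_flat_eq H L
  have he1 : |p₁ - s| ≤ B * pt := by
    rw [hs]; exact abs_nodeVal_root_sub_sum_le_gamma hu hn hT hLf
  have hSt := sum_abs_flat_le hu hn4 hT hLf
  have hs_le : |s| ≤ |p₁| + B * pt := by
    have := abs_sub_abs_le_abs_sub s p₁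
    rw [abs_sub_comm] at this
    linarith
  have htri : |res - p₁| ≤ |res - s| + |p₁ - s| := by
    rw [abs_sub_comm p₁ s]; exact abs_sub_le res s p₁
  have h1 : α * |s| ≤ α * (|p₁| + B * pt) := mul_le_mul_of_nonneg_left hs_le hα
  have h2 : β * ∑ t ∈ range (2 ^ (L + 1) - 1), |flat H t| ≤ β * (|p₁| + gamma u (4 * (d + L)) * pt) :=
    mul_le_mul_of_nonneg_left hSt hβ
  nlinarith [hres, he1, htri, h1, h2]

/-- The size of Theorem 18's first-order constant under its own hypothesis: `4Mu ≤ 1`, `M ≥ 1` give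
`γ_M ≤ 1/3`, `u ≤ 1/4`, hence `u + 3γ²_M ≤ 1`. [cite: GraillatLangloisLouvet2009, §6.1 Theorem 18] -/
theorem alpha_le_one {u : K} (hu : 0 ≤ u) {M : ℕ} (hM1 : 1 ≤ M) (hM4 : 4 * (((M : ℕ) : K) * u) ≤ 1) :
    u + 3 * gamma u M ^ 2 ≤ 1 := by
  have hc : (1 : K) ≤ (M : K) := by exact_mod_cast hM1
  have ht0 : 0 ≤ (M : K) * u := by positivity
  have hu4 : u ≤ (M : K) * u := by nlinarith
  have hγ : gamma u M ≤ 1 / 3 := by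
    unfold gamma
    rw [div_le_div_iff₀ (by linarith) (by norm_num)]
    linarith
  have hγ0 : 0 ≤ gamma u M := gamma_nonneg hu (by linarith)
  nlinarith [mul_le_mul hγ hγ hγ0 (by norm_num)]

/-- THEOREM 20 in the form of the LAST DISPLAY OF ITS PROOF — in fact slightly better, WITHOUT its
`γ₄ₙ^{K+1} p̃₁` term: for `2 ≤ K` (`1 ≤ L`), `4nu < 1` and Theorem 18's `4Mu ≤ 1` (`M = 2^K - 2`),
`|res - p₁(x)| ≤ (u + 3γ²_{2^K-2} + γ^K_{2^{K+1}-4})|p₁(x)| + (γ₂ₙ γ₄ₙ^{K-1} + γ₄ₙ γ^K_{2^{K+1}-4}) p̃₁(x)`.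
Why no extra term: the printed proof bounds `e₁` and `|s| - |p₁|` by `γ₂ₙγ₄ₙ^{K-1} p̃₁` and then
silently uses `(u + 3γ²_M) γ₂ₙ γ₄ₙ^{K-1} ≤ γ₄ₙ^{K+1}` (i.e. `(u + 3γ²_M) γ₂ₙ ≤ γ₄ₙ²`, roughly
`3M²u ≤ 8n` — not implied by the hypotheses when `K` is large against `n`); the level-wise Proposition 17 gives `γ_{2d} γ₂ₙ^{K-1}` instead, and
`2γ₂ₙ ≤ γ₄ₙ` leaves a factor `2^{K-1} ≥ 2 ≥ 1 + u + 3γ²_M` (`alpha_le_one`) of room.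
NOTE ON (24) AS PRINTED: the statement of Theorem 20 prints the middle `p̃₁` term as
`γ₂ₙ₊₁ γ^K_{2^{K+1}-4}`, whereas its proof (Lemma 21: `s̃ ≤ |p₁| + γ₄ₙ p̃₁`) yields `γ₄ₙ γ^K_{2^{K+1}-4}`;
we formalise what the proof proves (`abs_compHornerK_sub_le_gamma_four` has the shape of (24)).
[cite: GraillatLangloisLouvet2009, §6.2 Theorem 20 eq. (24) and proof] -/
theorem abs_compHornerK_sub_le_gamma {u x : K} (hu : 0 ≤ u) {d L : ℕ} (hL : 1 ≤ L)
    (hn4 : ((4 * (d + L) : ℕ) : K) * u < 1) (hM4 : 4 * ((((2 ^ (L + 1) - 2 : ℕ)) : K) * u) ≤ 1)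
    {A S P : ℕ → ℕ → ℕ → K} {H : ℕ → ℕ → K} {E Δ : ℕ → ℕ → K} (hT : IsEFTHornerK u x d L A S P H)
    (hLf : IsLeafHorner u x d L A H E Δ) {res : K}
    (hres : |res - ∑ t ∈ range (2 ^ (L + 1) - 1), flat H t|
      ≤ (u + 3 * gamma u (2 ^ (L + 1) - 2) ^ 2) * |∑ t ∈ range (2 ^ (L + 1) - 1), flat H t|
        + gamma u (2 * (2 ^ (L + 1) - 2)) ^ (L + 1) * ∑ t ∈ range (2 ^ (L + 1) - 1), |flat H t|) :
    |res - nodeVal x d L A 0 0|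
      ≤ (u + 3 * gamma u (2 ^ (L + 1) - 2) ^ 2 + gamma u (2 * (2 ^ (L + 1) - 2)) ^ (L + 1))
          * |nodeVal x d L A 0 0|
        + (gamma u (2 * (d + L)) * gamma u (4 * (d + L)) ^ L
            + gamma u (4 * (d + L)) * gamma u (2 * (2 ^ (L + 1) - 2)) ^ (L + 1))
          * nodeAbs x d L A 0 0 := by
  obtain ⟨L', rfl⟩ : ∃ L', L = L' + 1 := ⟨L - 1, by omega⟩
  have hM : ((2 * (2 ^ (L' + 1 + 1) - 2) : ℕ) : K) * u < 1 := by push_cast at hM4 ⊢; nlinarith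
  have h4 : 4 ≤ 2 ^ (L' + 1 + 1) := by
    calc 4 = 2 ^ 2 := by norm_num
      _ ≤ 2 ^ (L' + 1 + 1) := Nat.pow_le_pow_right (by norm_num) (by omega)
  have hα1 := alpha_le_one hu (show 1 ≤ 2 ^ (L' + 1 + 1) - 2 by omega) hM4
  have hsharp := abs_compHornerK_sub_le hu hn4 hM hT hLf hres
  have hn : ((2 * (d + (L' + 1)) : ℕ) : K) * u < 1 := by
    refine lt_of_le_of_lt (mul_le_mul_of_nonneg_right ?_ hu) hn4
    exact_mod_cast (show 2 * (d + (L' + 1)) ≤ 4 * (d + (L' + 1)) by omega)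
  have hd : ((2 * d : ℕ) : K) * u < 1 := by
    refine lt_of_le_of_lt (mul_le_mul_of_nonneg_right ?_ hu) hn
    exact_mod_cast (show 2 * d ≤ 2 * (d + (L' + 1)) by omega)
  have e44 : 2 * (2 * (d + (L' + 1))) = 4 * (d + (L' + 1)) := by ring
  have htwo : 2 * gamma u (2 * (d + (L' + 1))) ≤ gamma u (4 * (d + (L' + 1))) := by
    have := two_mul_gamma_le_gamma_two_mul hu (m := 2 * (d + (L' + 1))) (by rw [e44]; exact hn4)
    rwa [e44] at this
  set pt := nodeAbs x d (L' + 1) A 0 0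
  set α := u + 3 * gamma u (2 ^ (L' + 1 + 1) - 2) ^ 2
  set β := gamma u (2 * (2 ^ (L' + 1 + 1) - 2)) ^ (L' + 1 + 1)
  set g2 := gamma u (2 * (d + (L' + 1)))
  set g4 := gamma u (4 * (d + (L' + 1)))
  set gd := gamma u (2 * d)
  have hg2 : 0 ≤ g2 := gamma_nonneg hu hn
  have hg4 : 0 ≤ g4 := gamma_nonneg hu hn4
  have hgd : 0 ≤ gd := gamma_nonneg hu hd
  have hpt : 0 ≤ pt := nodeAbs_nonneg x d (L' + 1) A 0 0
  have hd2 : gd ≤ g2 := gamma_mono hu (by omega) hn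
  -- the factor of room: `2 γ₂ₙ^L ≤ γ₄ₙ^L` for `L ≥ 1`
  have h2pow : 2 * g2 ^ (L' + 1) ≤ g4 ^ (L' + 1) := by
    have h1 : (2 * g2) ^ (L' + 1) ≤ g4 ^ (L' + 1) := pow_le_pow_left₀ (by positivity) htwo _
    have h2 : (2 : K) ≤ 2 ^ (L' + 1) := by
      calc (2 : K) = 2 ^ 1 := by norm_num
        _ ≤ 2 ^ (L' + 1) := pow_le_pow_right₀ (by norm_num) (by omega)
    have h3 : 2 * g2 ^ (L' + 1) ≤ 2 ^ (L' + 1) * g2 ^ (L' + 1) :=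
      mul_le_mul_of_nonneg_right h2 (pow_nonneg hg2 _)
    rw [mul_pow] at h1
    linarith
  -- `(1 + α) γ_{2d} γ₂ₙ^L ≤ 2 γ_{2d} γ₂ₙ^L ≤ γ_{2d} γ₄ₙ^L ≤ γ₂ₙ γ₄ₙ^L`
  have hB0 : 0 ≤ gd * g2 ^ (L' + 1) := mul_nonneg hgd (pow_nonneg hg2 _)
  have hmain : (1 + u + 3 * gamma u (2 ^ (L' + 1 + 1) - 2) ^ 2) * (gd * g2 ^ (L' + 1))
      ≤ g2 * g4 ^ (L' + 1) := by
    have h1 : (1 + u + 3 * gamma u (2 ^ (L' + 1 + 1) - 2) ^ 2) * (gd * g2 ^ (L' + 1))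
        ≤ 2 * (gd * g2 ^ (L' + 1)) := mul_le_mul_of_nonneg_right (by linarith) hB0
    have h2 : gd * (2 * g2 ^ (L' + 1)) ≤ gd * g4 ^ (L' + 1) := mul_le_mul_of_nonneg_left h2pow hgd
    have h3 : gd * g4 ^ (L' + 1) ≤ g2 * g4 ^ (L' + 1) :=
      mul_le_mul_of_nonneg_right hd2 (pow_nonneg hg4 _)
    linarith
  nlinarith [hsharp, mul_le_mul_of_nonneg_right hmain hpt, abs_nonneg (nodeVal x d (L' + 1) A 0 0)]

/-- THEOREM 20 in the SHAPE OF (24) (with the proof's middle constant `γ₄ₙ`, see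
`abs_compHornerK_sub_le_gamma`; `γ₂ₙγ₄ₙ^{K-1} ≤ γ₄ₙ^K`, and the `γ₄ₙ^{K+1}` term is kept only to
match the print): for `2 ≤ K`, `4nu < 1`, `4(2^K - 2)u ≤ 1`,
`|res - p₁(x)| ≤ (u + 3γ²_{2^K-2} + γ^K_{2^{K+1}-4})|p₁(x)| + (γ₄ₙ^K + γ₄ₙ γ^K_{2^{K+1}-4} + γ₄ₙ^{K+1}) p̃₁(x)`.
[cite: GraillatLangloisLouvet2009, §6.2 Theorem 20 eq. (24)] -/
theorem abs_compHornerK_sub_le_gamma_four {u x : K} (hu : 0 ≤ u) {d L : ℕ} (hL : 1 ≤ L)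
    (hn4 : ((4 * (d + L) : ℕ) : K) * u < 1) (hM4 : 4 * ((((2 ^ (L + 1) - 2 : ℕ)) : K) * u) ≤ 1)
    {A S P : ℕ → ℕ → ℕ → K} {H : ℕ → ℕ → K} {E Δ : ℕ → ℕ → K} (hT : IsEFTHornerK u x d L A S P H)
    (hLf : IsLeafHorner u x d L A H E Δ) {res : K}
    (hres : |res - ∑ t ∈ range (2 ^ (L + 1) - 1), flat H t|
      ≤ (u + 3 * gamma u (2 ^ (L + 1) - 2) ^ 2) * |∑ t ∈ range (2 ^ (L + 1) - 1), flat H t|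
        + gamma u (2 * (2 ^ (L + 1) - 2)) ^ (L + 1) * ∑ t ∈ range (2 ^ (L + 1) - 1), |flat H t|) :
    |res - nodeVal x d L A 0 0|
      ≤ (u + 3 * gamma u (2 ^ (L + 1) - 2) ^ 2 + gamma u (2 * (2 ^ (L + 1) - 2)) ^ (L + 1))
          * |nodeVal x d L A 0 0|
        + (gamma u (4 * (d + L)) ^ (L + 1)
            + gamma u (4 * (d + L)) * gamma u (2 * (2 ^ (L + 1) - 2)) ^ (L + 1)
            + gamma u (4 * (d + L)) ^ (L + 2))
          * nodeAbs x d L A 0 0 := by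
  have h := abs_compHornerK_sub_le_gamma hu hL hn4 hM4 hT hLf hres
  have hn : ((2 * (d + L) : ℕ) : K) * u < 1 := by
    refine lt_of_le_of_lt (mul_le_mul_of_nonneg_right ?_ hu) hn4
    exact_mod_cast (show 2 * (d + L) ≤ 4 * (d + L) by omega)
  have hg4 : 0 ≤ gamma u (4 * (d + L)) := gamma_nonneg hu hn4
  have h24 : gamma u (2 * (d + L)) ≤ gamma u (4 * (d + L)) := gamma_mono hu (by omega) hn4
  have hpow : gamma u (2 * (d + L)) * gamma u (4 * (d + L)) ^ L
      ≤ gamma u (4 * (d + L)) ^ (L + 1) := by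
    rw [pow_succ, mul_comm (gamma u (4 * (d + L)) ^ L)]
    exact mul_le_mul_of_nonneg_right h24 (pow_nonneg hg4 L)
  have hextra : 0 ≤ gamma u (4 * (d + L)) ^ (L + 2) * nodeAbs x d L A 0 0 :=
    mul_nonneg (pow_nonneg hg4 _) (nodeAbs_nonneg x d L A 0 0)
  nlinarith [h, mul_le_mul_of_nonneg_right hpow (nodeAbs_nonneg x d L A 0 0)]

/-- Eq. (22) / THEOREM 20 in RELATIVE form: dividing the sharp bound by `|p₁(x)|`,
`|res - p₁(x)| / |p₁(x)| ≤ (u + 3γ²_M + γ₂ₘ^K) + ((1 + u + 3γ²_M) γ_{2d} γ₂ₙ^{K-1} + γ₄ₙ γ₂ₘ^K) cond(p₁, x)`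
with `cond(p₁, x) = p̃₁(x)/|p₁(x)| = Higham2002.condPoly` (for `p₁(x) = 0` both sides are harmless by
`y / 0 = 0`): "`u + O(u²) + ((4nu)^K + O(u^{K+1})) cond(p₁, x)`".
[cite: GraillatLangloisLouvet2009, §6.1 eq. (22); §6.2 Theorem 20] -/
theorem abs_compHornerK_sub_div_le {u x : K} (hu : 0 ≤ u) {d L : ℕ}
    (hn4 : ((4 * (d + L) : ℕ) : K) * u < 1) (hM : ((2 * (2 ^ (L + 1) - 2) : ℕ) : K) * u < 1)
    {A S P : ℕ → ℕ → ℕ → K} {H : ℕ → ℕ → K} {E Δ : ℕ → ℕ → K} (hT : IsEFTHornerK u x d L A S P H)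
    (hLf : IsLeafHorner u x d L A H E Δ) {res : K}
    (hres : |res - ∑ t ∈ range (2 ^ (L + 1) - 1), flat H t|
      ≤ (u + 3 * gamma u (2 ^ (L + 1) - 2) ^ 2) * |∑ t ∈ range (2 ^ (L + 1) - 1), flat H t|
        + gamma u (2 * (2 ^ (L + 1) - 2)) ^ (L + 1) * ∑ t ∈ range (2 ^ (L + 1) - 1), |flat H t|) :
    |res - nodeVal x d L A 0 0| / |nodeVal x d L A 0 0|
      ≤ (u + 3 * gamma u (2 ^ (L + 1) - 2) ^ 2 + gamma u (2 * (2 ^ (L + 1) - 2)) ^ (L + 1))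
        + ((1 + u + 3 * gamma u (2 ^ (L + 1) - 2) ^ 2) * (gamma u (2 * d) * gamma u (2 * (d + L)) ^ L)
            + gamma u (4 * (d + L)) * gamma u (2 * (2 ^ (L + 1) - 2)) ^ (L + 1))
          * condPoly (A 0 0) x (d + L) := by
  have h := abs_compHornerK_sub_le hu hn4 hM hT hLf hres
  have hn : ((2 * (d + L) : ℕ) : K) * u < 1 := by
    refine lt_of_le_of_lt (mul_le_mul_of_nonneg_right ?_ hu) hn4
    exact_mod_cast (show 2 * (d + L) ≤ 4 * (d + L) by omega)
  have hd : ((2 * d : ℕ) : K) * u < 1 := by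
    refine lt_of_le_of_lt (mul_le_mul_of_nonneg_right ?_ hu) hn
    exact_mod_cast (show 2 * d ≤ 2 * (d + L) by omega)
  have hcond : condPoly (A 0 0) x (d + L) = nodeAbs x d L A 0 0 / |nodeVal x d L A 0 0| := by
    simp only [condPoly, nodeAbs, nodeVal, Nat.sub_zero]
  rw [hcond]
  set P₁ := nodeVal x d L A 0 0
  set pt := nodeAbs x d L A 0 0
  set c₁ := u + 3 * gamma u (2 ^ (L + 1) - 2) ^ 2 + gamma u (2 * (2 ^ (L + 1) - 2)) ^ (L + 1)
  set c₂ := (1 + u + 3 * gamma u (2 ^ (L + 1) - 2) ^ 2) * (gamma u (2 * d) * gamma u (2 * (d + L)) ^ L)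
            + gamma u (4 * (d + L)) * gamma u (2 * (2 ^ (L + 1) - 2)) ^ (L + 1)
  have hc₁ : 0 ≤ c₁ := by
    have : 0 ≤ gamma u (2 * (2 ^ (L + 1) - 2)) ^ (L + 1) := pow_nonneg (gamma_nonneg hu hM) _
    positivity
  rcases eq_or_lt_of_le (abs_nonneg P₁) with hP | hP
  · rw [← hP]; simp [hc₁]
  · rw [div_le_iff₀ hP, add_mul, mul_assoc, div_mul_cancel₀ _ (ne_of_gt hP)]
    exact h

/-- THEOREM 20 ON A FULL TRACE (Algorithm 19, all three lines, in MODEL form): the final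
`r = SumK((hᵢ)_{i ∈ N_T}, K)` is given as `K - 1 = L` error-free vector transformations `Pv k ↦ Pv (k+1)`
(`GraillatJezequelPicot2018.IsVecSumPass`, radius `u`) of the row `Pv 0 = flat h` of
`2^K - 1 = M + 1` node values followed by a recursive summation `acc` of the last vector; THEOREM 18
(= `GraillatJezequelPicot2018.abs_sumK_recSum_sub_sum_le`, `v = u`, which needs `4Mu ≤ 1`) then
supplies (23), and the sharp bound of `abs_compHornerK_sub_le` holds for `res = acc M`.
[cite: GraillatLangloisLouvet2009, §6.2 Algorithm 19, Theorem 20; §6.1 Theorem 18]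
[cite: OgitaRumpOishi2005] -/
theorem abs_compHornerK_sub_le_of_sumK {u x : K} (hu : 0 ≤ u) {d L : ℕ} (hL : 1 ≤ L)
    (hn4 : ((4 * (d + L) : ℕ) : K) * u < 1) (hM4 : 4 * ((((2 ^ (L + 1) - 2 : ℕ)) : K) * u) ≤ 1)
    {A S P : ℕ → ℕ → ℕ → K} {H : ℕ → ℕ → K} {E Δ : ℕ → ℕ → K} (hT : IsEFTHornerK u x d L A S P H)
    (hLf : IsLeafHorner u x d L A H E Δ) (Pv Acc : ℕ → ℕ → K)
    (hP0 : ∀ t, Pv 0 t = flat H t)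
    (hpass : ∀ k < L, IsVecSumPass u (2 ^ (L + 1) - 2) (Pv k) (Acc k) (Pv (k + 1)))
    (acc : ℕ → K) (hacc0 : acc 0 = Pv L 0)
    (hacc : ∀ i < 2 ^ (L + 1) - 2,
      |acc (i + 1) - (acc i + Pv L (i + 1))| ≤ u * |acc i + Pv L (i + 1)|) :
    |acc (2 ^ (L + 1) - 2) - nodeVal x d L A 0 0|
      ≤ (u + 3 * gamma u (2 ^ (L + 1) - 2) ^ 2 + gamma u (2 * (2 ^ (L + 1) - 2)) ^ (L + 1))
          * |nodeVal x d L A 0 0|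
        + ((1 + u + 3 * gamma u (2 ^ (L + 1) - 2) ^ 2) * (gamma u (2 * d) * gamma u (2 * (d + L)) ^ L)
            + gamma u (4 * (d + L)) * gamma u (2 * (2 ^ (L + 1) - 2)) ^ (L + 1))
          * nodeAbs x d L A 0 0 := by
  obtain ⟨L', rfl⟩ : ∃ L', L = L' + 1 := ⟨L - 1, by omega⟩
  have hM : ((2 * (2 ^ (L' + 1 + 1) - 2) : ℕ) : K) * u < 1 := by push_cast at hM4 ⊢; nlinarith
  have h2 : 2 ≤ 2 ^ (L' + 1 + 1) := by
    calc 2 = 2 ^ 1 := by norm_num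
      _ ≤ 2 ^ (L' + 1 + 1) := Nat.pow_le_pow_right (by norm_num) (by omega)
  have hMN : 2 ^ (L' + 1 + 1) - 2 + 1 = 2 ^ (L' + 1 + 1) - 1 := by omega
  have hK := abs_sumK_recSum_sub_sum_le hu hM4 Pv Acc L' hpass acc hacc0 hacc
  rw [hMN] at hK
  have hrow : ∑ i ∈ range (2 ^ (L' + 1 + 1) - 1), Pv 0 i
      = ∑ t ∈ range (2 ^ (L' + 1 + 1) - 1), flat H t := Finset.sum_congr rfl fun t _ => hP0 t
  have hrow' : ∑ i ∈ range (2 ^ (L' + 1 + 1) - 1), |Pv 0 i|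
      = ∑ t ∈ range (2 ^ (L' + 1 + 1) - 1), |flat H t| :=
    Finset.sum_congr rfl fun t _ => by rw [hP0 t]
  rw [hrow, hrow'] at hK
  exact abs_compHornerK_sub_le hu hn4 hM hT hLf hK

/-! ## Algorithms 15 and 19 LITERALLY, for an executable rounding model `rd`

Every operation result is passed through one map `rd : K → K` with `|rd t - t| ≤ u |t|` (the
standard model (4) with `rd t = t(1+ε)`), and the two error-free transformations return the EXACT
errors `y = a ∘ b - rd (a ∘ b)` (eq. (6), Theorem 4) — as in `GraillatJezequelPicot2018.sumK` /
`GraillatJezequel2020.compHornerRd`. This section shows that the trace hypotheses `IsEFTHornerK`,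
`IsLeafHorner` and (23) are all met by this model, so the bounds above are statements about an
actual (idealised) execution of Algorithm 19. -/

/-- The relative error of one rounded result: `rd t = t (1 + relErr rd t)` (for `t = 0`, `rd 0 = 0` is
forced by `|rd 0 - 0| ≤ u·0` and Lean's `y / 0 = 0` gives `relErr rd 0 = 0`).
[cite: GraillatLangloisLouvet2009, §2.1 eq. (4)] -/
def relErr (rd : K → K) (t : K) : K := (rd t - t) / t

/-- `rd t = t (1 + ε)`, `ε = relErr rd t`. [cite: GraillatLangloisLouvet2009, §2.1 eq. (4)] -/
theorem mul_one_add_relErr {rd : K → K} {u : K} (hacc : ∀ t, |rd t - t| ≤ u * |t|) (t : K) :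
    t * (1 + relErr rd t) = rd t := by
  unfold relErr
  rcases eq_or_ne t 0 with rfl | ht
  · have h := hacc 0
    simp only [sub_zero, abs_zero, mul_zero] at h
    have h0 : rd 0 = 0 := abs_nonpos_iff.mp h
    simp [h0]
  · field_simp
    ring

/-- `|ε| ≤ u` in `rd t = t (1 + ε)`. [cite: GraillatLangloisLouvet2009, §2.1 eq. (4)] -/
theorem abs_relErr_le {rd : K → K} {u : K} (hu : 0 ≤ u) (hacc : ∀ t, |rd t - t| ≤ u * |t|)
    (t : K) : |relErr rd t| ≤ u := by
  unfold relErr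
  rcases eq_or_ne t 0 with rfl | ht
  · simp [hu]
  · rw [abs_div, div_le_iff₀ (abs_pos.mpr ht)]
    exact hacc t

/-- `Horner` under `rd` IS a run of the standard-model Horner `Higham2002.hornerFl`, with the relative
errors read off the trace (`sᵢ₊₁ = GraillatJezequelPicot2018.compHornerRdHigh rd x c m (i+1)`):
`hornerRd rd x c m = hornerFl x c (εᵢ := relErr rd (sᵢ₊₁ x)) (δᵢ := relErr rd (rd (sᵢ₊₁ x) + cᵢ)) m`.
[cite: GraillatLangloisLouvet2009, §3.1 Algorithm 5; §2.1 eq. (4)] -/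
theorem hornerRd_eq_hornerFl {rd : K → K} {u : K} (hacc : ∀ t, |rd t - t| ≤ u * |t|) (x : K) :
    ∀ (m : ℕ) (c : ℕ → K), hornerRd rd x c m
      = hornerFl x c (fun k => relErr rd (compHornerRdHigh rd x c m (k + 1) * x))
          (fun k => relErr rd (rd (compHornerRdHigh rd x c m (k + 1) * x) + c k)) m
  | 0, _ => rfl
  | m + 1, c => by
      have ih := hornerRd_eq_hornerFl hacc x m (fun k => c (k + 1))
      have e1 : ∀ i, compHornerRdHigh rd x c (m + 1) (i + 1)
          = compHornerRdHigh rd x (fun k => c (k + 1)) m i := fun _ => rfl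
      simp only [hornerFl, hornerRd, e1, compHornerRdHigh_zero]
      rw [← ih, mul_one_add_relErr hacc, mul_one_add_relErr hacc]

/-- The two children produced by `EFTHorner` (Algorithm 6 under `rd`, exact `TwoProd`/`TwoSum`) run
on a node with coefficients `c` and degree `m`: parity `0` ↦ `p_π`, `πᵢ = sᵢ₊₁ x - rd (sᵢ₊₁ x)`;
parity `1` ↦ `p_σ`, `σᵢ = (pᵢ + cᵢ) - rd (pᵢ + cᵢ)`, `pᵢ = rd (sᵢ₊₁ x)`.
[cite: GraillatLangloisLouvet2009, §3.2 Algorithm 6; §2.2 Theorem 4; §5.1 eq. (17)] -/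
def childCoeff (rd : K → K) (x : K) (c : ℕ → K) (m : ℕ) : ℕ → ℕ → K
  | 0, i => compHornerRdHigh rd x c m (i + 1) * x - rd (compHornerRdHigh rd x c m (i + 1) * x)
  | _ + 1, i => rd (compHornerRdHigh rd x c m (i + 1) * x) + c i
      - rd (rd (compHornerRdHigh rd x c m (i + 1) * x) + c i)

/-- ALGORITHM 15 (`EFTHornerK`) under `rd`: the coefficients of every node polynomial of the tree,
`p_{(0,0)} = p₁ = a` (degree `d + L`), `p_{(ℓ+1, j)} =` the `π`-child (`j` even) / `σ`-child (`j` odd)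
of `p_{(ℓ, ⌊j/2⌋)}` (eq. (17): `[hᵢ, p₂ᵢ, p₂ᵢ₊₁] = EFTHorner(pᵢ, x)`).
[cite: GraillatLangloisLouvet2009, §5.1 Algorithm 15, eq. (17)] -/
def treeCoeff (rd : K → K) (x : K) (a : ℕ → K) (d L : ℕ) : ℕ → ℕ → ℕ → K
  | 0, _ => a
  | ℓ + 1, j => childCoeff rd x (treeCoeff rd x a d L ℓ (j / 2)) (d + (L - ℓ)) (j % 2)

/-- The `EFTHorner` running values `sᵢ` of node `(ℓ, j)` under `rd`.
[cite: GraillatLangloisLouvet2009, §3.2 Algorithm 6; §5.1 Algorithm 15] -/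
def treeS (rd : K → K) (x : K) (a : ℕ → K) (d L : ℕ) (ℓ j i : ℕ) : K :=
  compHornerRdHigh rd x (treeCoeff rd x a d L ℓ j) (d + (L - ℓ)) i

/-- The rounded products `pᵢ = rd (sᵢ₊₁ x)` of node `(ℓ, j)` under `rd`.
[cite: GraillatLangloisLouvet2009, §3.2 Algorithm 6; §5.1 Algorithm 15] -/
def treeP (rd : K → K) (x : K) (a : ℕ → K) (d L : ℕ) (ℓ j i : ℕ) : K :=
  rd (treeS rd x a d L ℓ j (i + 1) * x)

/-- The node values `hᵢ = Horner(pᵢ, x)` under `rd` — for internal nodes this is `s₀` of `EFTHorner`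
(Theorem 7 (i)), for the leaves it is line 2 of Algorithm 19.
[cite: GraillatLangloisLouvet2009, §5.1 Algorithm 15; §6.2 Algorithm 19] -/
def treeH (rd : K → K) (x : K) (a : ℕ → K) (d L : ℕ) (ℓ j : ℕ) : K :=
  hornerRd rd x (treeCoeff rd x a d L ℓ j) (d + (L - ℓ))

/-- The relative errors `εₖ` of the products in the leaf evaluations (Algorithm 19, line 2).
[cite: GraillatLangloisLouvet2009, §6.2 Algorithm 19; §2.1 eq. (4)] -/
def treeE (rd : K → K) (x : K) (a : ℕ → K) (d L : ℕ) (j : ℕ) : ℕ → K :=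
  fun k => relErr rd (treeS rd x a d L L j (k + 1) * x)

/-- The relative errors `δₖ` of the additions in the leaf evaluations (Algorithm 19, line 2).
[cite: GraillatLangloisLouvet2009, §6.2 Algorithm 19; §2.1 eq. (4)] -/
def treeΔ (rd : K → K) (x : K) (a : ℕ → K) (d L : ℕ) (j : ℕ) : ℕ → K :=
  fun k => relErr rd (rd (treeS rd x a d L L j (k + 1) * x) + treeCoeff rd x a d L L j k)

/-- ALGORITHM 19 (`CompHornerK(p₁, x, K)`, `K = L + 1`, leaves of degree `d`, `n = d + L`) under `rd`:
`SumK` (`GraillatJezequelPicot2018.sumK`, `K - 1 = L` passes) of the row of the `2^K - 1` node values.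
[cite: GraillatLangloisLouvet2009, §6.2 Algorithm 19] -/
def compHornerK (rd : K → K) (x : K) (a : ℕ → K) (d L : ℕ) : K :=
  sumK rd (2 ^ (L + 1) - 2) (flat (treeH rd x a d L)) (L - 1)

omit [IsStrictOrderedRing K] in
/-- Under `|rd t - t| ≤ u|t|` the `rd`-tree IS an `EFTHornerK` trace (Theorem 4: the transformations
are exact, eq. (6), and their errors are `u`-small, `|y| ≤ u|a ∘ b|`). [cite: GraillatLangloisLouvet2009, §5.1 Algorithm 15;
§2.2 Theorem 4; §3.2 Theorem 7] -/
theorem isEFTHornerK_tree {rd : K → K} {u : K} (hacc : ∀ t, |rd t - t| ≤ u * |t|) (x : K)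
    (a : ℕ → K) (d L : ℕ) :
    IsEFTHornerK u x d L (treeCoeff rd x a d L) (treeS rd x a d L) (treeP rd x a d L)
      (treeH rd x a d L) where
  top ℓ hℓ j _ := by
    have e : d + (L - 1 - ℓ) + 1 = d + (L - ℓ) := by omega
    simp only [treeS, e]
    exact compHornerRdHigh_self rd x _ _
  prod ℓ _ j _ i _ := by
    simp only [treeS, treeP, treeCoeff, Nat.mul_mod_right,
      Nat.mul_div_cancel_left j (by norm_num : (0 : ℕ) < 2), childCoeff]
    ring
  sum ℓ hℓ j _ i hi := by
    have h1 : (2 * j + 1) % 2 = 1 := by omega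
    have h2 : (2 * j + 1) / 2 = j := by omega
    have hstep := compHornerRdHigh_step rd x (d + (L - ℓ)) (treeCoeff rd x a d L ℓ j) i (by omega)
    simp only [treeS, treeP, treeCoeff, h1, h2, childCoeff]
    rw [hstep]
    ring
  prod_err ℓ _ j _ i _ := by
    simp only [treeS, treeCoeff, Nat.mul_mod_right,
      Nat.mul_div_cancel_left j (by norm_num : (0 : ℕ) < 2), childCoeff]
    rw [abs_sub_comm]
    exact hacc _
  sum_err ℓ _ j _ i _ := by
    have h1 : (2 * j + 1) % 2 = 1 := by omega
    have h2 : (2 * j + 1) / 2 = j := by omega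
    simp only [treeS, treeP, treeCoeff, h1, h2, childCoeff]
    rw [abs_sub_comm]
    exact hacc _
  val ℓ _ j _ := by
    simp only [treeH, treeS, compHornerRdHigh_zero]

/-- Under `|rd t - t| ≤ u|t|` the leaves of the `rd`-tree are standard-model Horner runs.
[cite: GraillatLangloisLouvet2009, §6.2 Algorithm 19 line 2; §2.1 eq. (4); §3.1 eq. (8)] -/
theorem isLeafHorner_tree {rd : K → K} {u : K} (hu : 0 ≤ u) (hacc : ∀ t, |rd t - t| ≤ u * |t|)
    (x : K) (a : ℕ → K) (d L : ℕ) :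
    IsLeafHorner u x d L (treeCoeff rd x a d L) (treeH rd x a d L) (treeE rd x a d L)
      (treeΔ rd x a d L) where
  err_prod _ _ _ := abs_relErr_le hu hacc _
  err_sum _ _ _ := abs_relErr_le hu hacc _
  val j _ := by
    show hornerRd rd x (treeCoeff rd x a d L L j) (d + (L - L))
      = hornerFl x (treeCoeff rd x a d L L j)
          (fun k => relErr rd (treeS rd x a d L L j (k + 1) * x))
          (fun k => relErr rd (rd (treeS rd x a d L L j (k + 1) * x) + treeCoeff rd x a d L L j k))
          d
    simp only [treeS, Nat.sub_self, add_zero]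
    exact hornerRd_eq_hornerFl hacc x d _

/-- THEOREM 20 LITERALLY for the executable model `compHornerK rd x a d L` (`K = L + 1 ≥ 2`,
`n = d + L`, `M = 2^K - 2`) under `|rd t - t| ≤ u|t|`, `4nu < 1`, `4Mu ≤ 1`: the sharp bound of
`abs_compHornerK_sub_le` with `p₁ = Σ_{i ≤ n} aᵢ xⁱ`, `p̃₁ = Σ_{i ≤ n} |aᵢ| |x|ⁱ` (Theorem 18 supplied by
`GraillatJezequelPicot2018.abs_sumK_sub_sum_le_of_rd`).
[cite: GraillatLangloisLouvet2009, §6.2 Theorem 20, Algorithm 19; §6.1 Theorem 18]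
[cite: OgitaRumpOishi2005] -/
theorem abs_compHornerK_rd_sub_le {rd : K → K} {u : K} (hu : 0 ≤ u)
    (hacc : ∀ t, |rd t - t| ≤ u * |t|) {d L : ℕ} (hL : 1 ≤ L)
    (hn4 : ((4 * (d + L) : ℕ) : K) * u < 1) (hM4 : 4 * ((((2 ^ (L + 1) - 2 : ℕ)) : K) * u) ≤ 1)
    (x : K) (a : ℕ → K) :
    |compHornerK rd x a d L - ∑ i ∈ range (d + L + 1), a i * x ^ i|
      ≤ (u + 3 * gamma u (2 ^ (L + 1) - 2) ^ 2 + gamma u (2 * (2 ^ (L + 1) - 2)) ^ (L + 1))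
          * |∑ i ∈ range (d + L + 1), a i * x ^ i|
        + ((1 + u + 3 * gamma u (2 ^ (L + 1) - 2) ^ 2) * (gamma u (2 * d) * gamma u (2 * (d + L)) ^ L)
            + gamma u (4 * (d + L)) * gamma u (2 * (2 ^ (L + 1) - 2)) ^ (L + 1))
          * ∑ i ∈ range (d + L + 1), |a i| * |x| ^ i := by
  obtain ⟨L', rfl⟩ : ∃ L', L = L' + 1 := ⟨L - 1, by omega⟩
  have hM : ((2 * (2 ^ (L' + 1 + 1) - 2) : ℕ) : K) * u < 1 := by push_cast at hM4 ⊢; nlinarith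
  have h2 : 2 ≤ 2 ^ (L' + 1 + 1) := by
    calc 2 = 2 ^ 1 := by norm_num
      _ ≤ 2 ^ (L' + 1 + 1) := Nat.pow_le_pow_right (by norm_num) (by omega)
  have hMN : 2 ^ (L' + 1 + 1) - 2 + 1 = 2 ^ (L' + 1 + 1) - 1 := by omega
  have hT := isEFTHornerK_tree hacc x a d (L' + 1)
  have hLf := isLeafHorner_tree hu hacc x a d (L' + 1)
  have hK := abs_sumK_sub_sum_le_of_rd hu hM4 hacc (flat (treeH rd x a d (L' + 1))) L'
  rw [hMN] at hK
  have h := abs_compHornerK_sub_le hu hn4 hM hT hLf hK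
  have eV : nodeVal x d (L' + 1) (treeCoeff rd x a d (L' + 1)) 0 0
      = ∑ i ∈ range (d + (L' + 1) + 1), a i * x ^ i := by
    simp only [nodeVal, treeCoeff, Nat.sub_zero]
  have eA : nodeAbs x d (L' + 1) (treeCoeff rd x a d (L' + 1)) 0 0
      = ∑ i ∈ range (d + (L' + 1) + 1), |a i| * |x| ^ i := by
    simp only [nodeAbs, treeCoeff, Nat.sub_zero]
  have eC : compHornerK rd x a d (L' + 1)
      = sumK rd (2 ^ (L' + 1 + 1) - 2) (flat (treeH rd x a d (L' + 1))) L' := by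
    simp only [compHornerK, Nat.add_sub_cancel]
  rw [eC, ← eV, ← eA]
  exact h

end Literature.ComputerArithmetic.GraillatLangloisLouvet2009
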